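import Literature.MathematicalPhysics.QuantumFieldTheory.Balaban1983to89.B3Ineq25RegularNested
import Literature.MathematicalPhysics.QuantumFieldTheory.Balaban1983to89.B3Norm132SmoothMultiplier

/-!
# Bałaban, *(Higgs)₂,₃ quantum fields in a finite volume III. Renormalization* [B3] — inequality (2.5) p. 424, the `δG_k(Ω,Ω₂,B̃)`
# alternative, WITH PRINT'S SMOOTH LOCALIZATION FUNCTIONS of p. 420: `‖hδG_k(Ω,Ω₂,B̃)h′‖_{1,α} ≤ O(e^{−δ₀dist(Ω₂,∂Ω)})e^{−δ₀dist(supp h,supp h′)}`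
# for `h, h′` smooth bumps supported in boxes of unit cubes, at a regular non-constant background `B̃ = A` on nested big-block regions
# `Ω₂ ⊆ Ω ⊂ T_η` — PROVED for a concrete carrier of `B3Sect2StatementsPart2.ScaledKernels` whose localization functions ARE the smooth bumps

statement-level skeleton of published theorems with citation tags; proofs where landed; nothing here is a claim about the Yang–Mills mass gap

T. Bałaban, Commun. Math. Phys. **88** (1983) 411–445 [cite: Balaban1983Higgs3]; inputs from part I, Commun. Math. Phys. **85** (1982) 603–626
[cite: Balaban1982Higgs1] as landed in the tree.  PDF held: `paper:balaban1983-higgs-2-3-quantum-fields-finite-volume` (journal page = PDF page + 410),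
p. 414 [PDF 4], p. 420 [PDF 10] (`p0010.txt`), p. 424 [PDF 14] (`p0014.txt`).

CITATION HEADER (lean-in-tree rule).  Cell `lit-balaban` (HOME `run/shared/lean/pub/lit-balaban/`), Phase-2 proof seat **p33** gen 61 (unit
`lit-balaban-p33`; TAKING line HOME/STATUS.md 2026-08-23T01:51:51Z, owner ruling r15 g14 01:57:42Z); SKELETON row **B3.Eq2.5** (fold owner r15; decl of
record `B3Sect2StatementsPart2.ScaledKernels.Ineq25At`); owner item `B3-CLOSURE.md` v1.21 §5 item 14 = the lead's Q7 condition (ii) «the smooth side-2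
localization class of p. 420 applied to δG_k».  After p33 g60's `B3Ineq25RegularNested` (p346606: (2.5) for `δG_k` with SHARP interior unit cubes as
localization functions).  USED BY NAME, never restated: p33 g60's `δG_k` blocks `blockKD`/`blockDKD`, their apply lemmas, the row move
`norm_hol_comp_blockDKD_sub_le`, the adjoint identity and column move `norm_blockDKD_comp_star_sub_le`, the margin/decay kernels `exp_margin_le`, and
the FOUR KERNEL ENTRIES OF `δG_k(Ω,Ω₂,A)` AT SCALE `k` — r14 g18's `B3DeltaGkKernelRegularNested.dG_kernel_bound_explicit`/`dG_kernel_deriv_bound_explicit`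
(p345219), p33 g60's `dG_holder_bound_explicit` (over p345432) and `dG_mixed_bound_explicit` (over p33 g58's p344322); THIS SEAT's generic multiplier
`B3Norm132SmoothMultiplier` (p348617: `kerM`/`valM`/`derivM`/`normM`, `normM_le`, `isSmoothLoc_of_lip`); p40 g69's localization class `IsSmoothLoc`, the
`η`-derivative `dEta`, the boxes `InBox`/`boxSet`/`inBox_of_mem_cpath`/`tdist_div_le_of_inBox`/`two_mul_box_le`, `smoothConst`
(`B3Ineq31SmoothLocalization`, p345208); p40 g68's product lattice `PSite`/`PBd`/`hb`/`dirOf`/`baseOf`/`pdist`/`unitV`/`unitD`/`transp`/`cpath`; r14's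
`Interior`/`regRegionKernels`/`IsBigBlockUnion`/`distC`; p35's chain transport `hol`/`norm_hol_apply_sub_le`; the printed SUM form (1.32)
`B3Sect1Statements.norm132`.

## What is printed (verbatim)

(2.5) p. 424 [PDF 14]: *"In the estimates we treat them as external fields and we use the inequalities:
‖h(an operator δG_k(Ω,Ω₂,B̃) or (1.16))h′‖_{1,α} ≤ O(e^{−δ₀dist(Ω₂,∂Ω)} or (e(L^kε)p(L^kε))^{n+n′})e^{−δ₀dist(supp h, supp h′)}, (2.5) where h, h′ are
functions giving the localizations of the vertices."*; p. 420 [PDF 10]: *"For the remaining vertices we localize, taking for each leg of the vector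
field a smooth partition of unity satisfying the condition that a support of each function is contained in a cube with sides of length 2."*; after
(1.33): *"if in a vertex v there is a leg of external field, then we multiply it by a smooth function h such that h = 1 on □(v) and h = 0 outside some
neighborhood of □(v)"*; (1.32) p. 420: *"‖f‖_{1,α} = sup_x|f(x)| + sup_{x,μ}|(D^η_{B̃,μ}f)(x)| + sup_{x,x′,μ}|x − x′|^{−α}|U(B̃(Γ_{x,x′}))(D^η_{B̃,μ}f)(x′)
− (D^η_{B̃,μ}f)(x)|, (1.32) … This definition extends in a natural way to functions of many variables."*

## What this file proves, and how

THE FIELD.  `G = (h ⊗ h′)·F`, `F(x,x′) = δG_k(Ω,Ω₂,A;x,x′)` in the print's `η`-units (p33 g60's blocks: `kvD x y = unitV·blockKD x y`,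
`kdD b y = unitD·blockDKD b y`), through THIS SEAT's generic multiplier: `kerM` (the localized field), `derivM` (its covariant `η`-derivatives along the
`2d` directions of the product lattice BY THE PRODUCT RULE — PROVED here to be the covariant difference quotients of `G`, `derivGD_inl`, and of the
column slice `x′ ↦ G(x,x′)^*`, `derivGD_inr`, by the symmetry `δG_k(x,y)^* = δG_k(y,x)` of both region kernels, `star_blockKD`), `normM` = the printed
SUM (1.32) over the WHOLE product lattice with the transports `U(A(Γ))∘·∘U(A(Γ′))^*` (`normHGHDS`).  THE LOCALIZATION FUNCTIONS: p40's class
`IsSmoothLoc k c₁ c₂ 1 S h` (`|h| ≤ 1`, `|∂^ηh| ≤ c₁`, `∂^ηh` Lipschitz with constant `c₂` in the `η`-units, support with its lattice collar in `S`) — what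
the lattice sees of a `C²` bump of p. 420; by `isSmoothLoc_of_lip` it is `α`-Hölder for every `0 ≤ α ≤ 1` (constant `c₂ + 2c₁`), so ONE class serves
all `α`.  THE DOMAINS: `DomD k K₀ Ω₂ r₀ m S` — `S` made of INTERIOR points of `Ω₂` (r14's `Interior`, the `R₀`-clause of every kernel entry) at lattice
distance `≥ r₀L^k` from `Ω₂ᶜ`, closed under the coordinatewise contours `cpath`, of diameter `≤ mL^k`; a box of `m^d` such unit cubes qualifies
(`domD_of_box`; `m = 2` for the side-2 cubes, `m = 3` for «`h = 1` on `□(v)`, `0` outside a neighbourhood»).  NO SEPARATION of the two domains is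
required (`δG_k` is regular on the diagonal): the pair distance is the free real `D ≥ 0` with `L^kD ≤ |x − x′|` on `S × S′`, and the carrier takes the
lattice distance of the two supports, `setDist`.

THE THEOREMS.  §1 the `δG_k` instance of the multiplier and the product-rule identities; §2 domains, boxes, `setDist`; §3 the FOUR BOUNDS of `F` on a
pair of admissible domains from the four kernel entries at scale `k` at interior points (value `sup_part_leDS`, derivative `deriv_raw_leDS`,
transported Hölder differences `holder_coreDS` = column move + row move with `|Δy|/L^k ≤ p ≤ mp^α` inside a domain, and the NEW value-Lipschitz clause
`value_move_leDS` = column move + row move of VALUES, each `η`-step one derivative of `F`), each `≤ const·e^{−δr₀}·e^{−δD}`; §4 **`normHGHDS_le`**: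
`‖hδG_k(Ω,Ω₂,A)h′‖_{1,α} ≤ (K(c₁,c₂+2c₁,d,m)(C_V + C_D) + C_H + dmC_M)·e^{−δr₀}·e^{−δD}` (generic `normM_le`); §5 the CARRIER `sect2DeltaSmooth`
(`LocFn` = `SmoothLocFn` = (support domain, bump) pairs; `distSupp` = `setDist`; `distΩ₂ := r₀`; `normDeltaG` = `normHGHDS`; `norm116 := 0`),
**`ineq25_smooth_of_bounds`** (the four scale-`k` entries ⇒ `Ineq25 α (min δᵢ) (K(C_V+C_D)+C_H+dmC_M)`, hence every `Ineq25At`), and the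
HYPOTHESIS-FREE PLUG **`ineq25_smooth_regularNested`** (same binder list as p33 g60's `ineq25_regularNested` plus `m`, `c₁`, `c₂`): for `d ≥ 1`,
`L ≥ 2`, `a, m² > 0`, `c ≥ 0`, `N`, `m`, `c₁, c₂ ≥ 0`: `∃E₀ ∀C (e² ≤ E₀) ∃K₀min ∀ 0 ≤ α < 1 ∀K₀ ≥ K₀min ∃ t δ₀ C > 0 ∀P … ∀Ω₂ ⊆ Ω big-block unions
∀A δ_A-regular on Ω (L^kδ_A|e| ≤ t, L^kδ_A ≤ c|e|) ∀r₀: (sect2DeltaSmooth _ C Ω Ω₂ A m² a k K₀ r₀ m c₁ c₂).Ineq25 α δ₀ C`; `SmoothLocFn.ofBox` builds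
the localization functions of boxes of interior cubes.

## Honest scope / declared divergences (F7)

(i) `distΩ₂ := r₀`, the common margin (in `η`-units) of the admitted supports from `Ω₂ᶜ` (p03's G-B3-14 reading, as in p33 g60's sharp-cube member).
(ii) The (1.16) alternative of (2.5) is NOT MODELLED (`norm116 := 0`; r14 g19's programme, item 11).  (iii) "Smooth" = p40's three discrete bounds at
exponent `1` with constants `c₁, c₂ ≥ 0` and the collar condition (print fixes no partition of unity; any with these bounds is admitted); supports in
domains of interior points of `Ω₂` at margin `≥ r₀L^k`, contour-closed, diameter `≤ mL^k`; `distSupp` = lattice distance of the two support DOMAINS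
(`≤` print's `dist(supp h, supp h′)` up to the collar).  (iv) `m² > 0`; `K₀ ∣ M`, `K₀ ≥ K₀min`, three big blocks a side; `e² ≤ E₀`, `L^kδ_A ≤ c|e|`
besides `L^kδ_A|e| ≤ t` (r14's FILE-1 currency); constants depend on `α`, `K₀`, `m`, `c₁`, `c₂` (GAPS G-B3-11); `|·|` of a block = operator norm; contours =
`cpath`.  No `def … : Prop`, no new named fact (all `def`s are concrete data / predicates with bodies); axioms standard.  Value = kernel certificate of the
smooth-localization reading of one located estimate of B3 §2 at a regular background on nested regions, NOT summit progress.
-/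

noncomputable section

open scoped BigOperators InnerProductSpace Matrix

namespace Literature.MathematicalPhysics.QuantumFieldTheory.Balaban1983to89.B3Ineq25SmoothLocalization

open HiggsLattice (ChargeData ScalarField siteInner covDeriv)
open HiggsCovariance (propagatorK E)
open HiggsAveraging (blockIter)
open B1Eq230FluctCov (Ix cb)
open B1Ineq234Concrete (distC distC_nonneg tdist_self)
open B1Ineq234LevelZero (tdist_comm)
open B1TorusChainTransport (IsTChain hol norm_hol_apply_sub_le hol_nil)
open B1TorusCubeCover (half)
open B1TorusRegionHSizes (IsBigBlockUnion)
open B4GaugeCovariance (pathEnd)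
open B3Sect2StatementsPart2 (ScaledKernels)
open B3Sect1Statements (norm132)
open B3Ineq210RegularTorus (mesh_eq_pow_mul)
open B3Ineq210RegularRegion (Interior regRegionKernels)
open B3Ineq211RegularTorus (IsAdm)
open B3Ineq210MixedRegularTorus (onb dip norm_covDeriv_dip_le_sum)
open B3Ineq210MixedRegularRegion (inner_propagatorK_single_comm_R)
open B3Ineq31RegularTorus (two_lt_sitesPerDir cpath isAdm_cpath pathEnd_cpath cpath_self PSite PBd hb dirOf baseOf pdist unitV unitD transp
  norm_hol_comp_le)
open B3Ineq31SmoothLocalization (dEta IsSmoothLoc InBox boxSet mem_boxSet inBox_of_mem_cpath tdist_div_le_of_inBox two_mul_box_le smoothConst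
  smoothConst_pos)
open B3Norm132SmoothMultiplier (kerM valM derivM normM normM_le derivM_inl derivM_inr isSmoothLoc_of_lip)
open B3DeltaPiecesRegularNested (dG)
open B3DeltaGkKernelRegularNested (dG_kernel_bound_explicit dG_kernel_deriv_bound_explicit)
open B3Ineq25RegularNested (blockKD blockDKD blockKD_apply blockDKD_apply norm_blockKD_le norm_blockDKD_le norm_hol_comp_blockDKD_sub_le
  norm_blockDKD_comp_star_sub_le exp_margin_le dG_holder_bound_explicit dG_mixed_bound_explicit)

variable {P : HiggsLattice.Params} {N : ℕ}

/-! ## §0 Arithmetic of the units -/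

section Units

variable {k : ℕ}

/-- `unitV > 0`. [folklore] -/
private theorem unitV_pos (P : HiggsLattice.Params) (k : ℕ) : 0 < unitV P k := by
  unfold unitV; have := P.mesh_pos k; have := P.mesh_pos 0; positivity

/-- `unitD > 0`. [folklore] -/
private theorem unitD_pos (P : HiggsLattice.Params) (k : ℕ) : 0 < unitD P k := by
  unfold unitD; have := P.mesh_pos k; have := P.mesh_pos 0; positivity

/-- weakening a decay rate. [folklore] -/
private theorem exp_rate_mono {δ δ' t : ℝ} (h : δ ≤ δ') (ht : 0 ≤ t) : Real.exp (-(δ' * t)) ≤ Real.exp (-(δ * t)) := by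
  rw [Real.exp_le_exp]; nlinarith

/-- monotonicity of a decay factor in the distance. [folklore] -/
private theorem exp_dist_mono {δ s s' : ℝ} (hδ : 0 ≤ δ) (h : s' ≤ s) : Real.exp (-(δ * s)) ≤ Real.exp (-(δ * s')) :=
  Real.exp_le_exp.mpr (neg_le_neg (mul_le_mul_of_nonneg_left h hδ))

/-- `unitV·ε = unitD/L^k`. [folklore] -/
private theorem unitV_mul_mesh (P : HiggsLattice.Params) (k : ℕ) : unitV P k * P.mesh 0 = unitD P k * ((P.L : ℝ) ^ k)⁻¹ := by
  unfold unitV unitD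
  rw [mesh_eq_pow_mul P k]
  have hε : P.mesh 0 ≠ 0 := (P.mesh_pos 0).ne'
  have hL : (P.L : ℝ) ^ k ≠ 0 := pow_ne_zero _ (by have := P.hL; positivity)
  field_simp

/-- `unitD·ε^{−1} = L^k·unitV`. [folklore] -/
private theorem unitD_mul_inv_mesh (P : HiggsLattice.Params) (k : ℕ) : unitD P k * (P.mesh 0)⁻¹ = (P.L : ℝ) ^ k * unitV P k := by
  unfold unitV unitD
  rw [mesh_eq_pow_mul P k]
  have hε : P.mesh 0 ≠ 0 := (P.mesh_pos 0).ne'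
  have hL : (P.L : ℝ) ^ k ≠ 0 := pow_ne_zero _ (by have := P.hL; positivity)
  field_simp

end Units

/-! ## §1 The `δG_k(Ω,Ω₂,A)` blocks in the multiplier's format, the symmetry of the kernel, the product rule as covariant difference quotient -/

section Blocks

variable (C : ChargeData N) (Ω Ω₂ : Finset (HiggsLattice.Site P 0)) (A : HiggsLattice.VecField P 0) (msq a : ℝ) (k : ℕ)

/-- **The value blocks of `F = δG_k(Ω,Ω₂,A)` in the print's `η`-units**, read from the differentiated variable: `kvD x y = (L^kε)^{d−2}ε^{−d}·δG_k(x,y)`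
(p33 g60's `kerFD` at `(x, y)`). [cite: Balaban1983Higgs3, (2.5) p.424, (1.16) p.414] -/
def kvD (x y : HiggsLattice.Site P 0) : E N →L[ℝ] E N := unitV P k • blockKD C Ω Ω₂ A msq a k x y

/-- **The `η`-derivative blocks of `F = δG_k(Ω,Ω₂,A)`**: `kdD b y = (L^kε)^{d−1}ε^{−d}·(D^ε_AδG_k)(b, y)` (p33 g60's `derivFD`).
[cite: Balaban1983Higgs3, (1.32) p.420] [cite: Balaban1982Higgs1, (1.7) p.605] -/
def kdD (b : HiggsLattice.PBond P 0) (y : HiggsLattice.Site P 0) : E N →L[ℝ] E N := unitD P k • blockDKD C Ω Ω₂ A msq a k b y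

/-- **`‖hδG_k(Ω,Ω₂,A)h′‖_{1,α}` WITH SMOOTH LOCALIZATION FUNCTIONS**: the printed (1.32) SUM norm of `G = (h ⊗ h′)·δG_k(Ω,Ω₂,A;·,·)` over the WHOLE
product lattice `T_η × T_η` (all sites, all `2d` directions of product bonds, Hölder quotients over same-direction pairs at the sup-distance `pdist`,
transports `U(A(Γ))∘·∘U(A(Γ′))^*` along the coordinatewise contours) — the generic `normM` at the `δG_k` blocks.
[cite: Balaban1983Higgs3, (2.5) p.424, (1.32) p.420] -/
def normHGHDS (α : ℝ) (h h' : HiggsLattice.Site P 0 → ℝ) : ℝ :=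
  normM C A k (kvD C Ω Ω₂ A msq a k) (kdD C Ω Ω₂ A msq a k) α h h'

variable {C Ω Ω₂ A msq a k}

/-- `normHGHDS` unfolds to the printed sum form of the localized field and its product-rule derivatives. [cite: Balaban1983Higgs3, (1.32) p.420] -/
theorem normHGHDS_eq (α : ℝ) (h h' : HiggsLattice.Site P 0 → ℝ) :
    normHGHDS C Ω Ω₂ A msq a k α h h'
      = norm132 α (fun c c' : PBd P => dirOf c = dirOf c') (fun c c' => pdist k (baseOf c) (baseOf c')) (transp C A)
          Finset.univ Finset.univ (kerM (kvD C Ω Ω₂ A msq a k) h h') (derivM k (kvD C Ω Ω₂ A msq a k) (kdD C Ω Ω₂ A msq a k) h h') :=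
  rfl

/-- the value block is p33 g60's two-variable field. [cite: Balaban1983Higgs3, (2.5) p.424] -/
theorem kvD_eq_kerFD (x y : HiggsLattice.Site P 0) : kvD C Ω Ω₂ A msq a k x y = B3Ineq25RegularNested.kerFD C Ω Ω₂ A msq a k (x, y) := rfl

/-- the derivative block is p33 g60's derivative field. [cite: Balaban1983Higgs3, (1.32) p.420] -/
theorem kdD_eq_derivFD (c : PBd P) :
    kdD C Ω Ω₂ A msq a k (hb c).1 (hb c).2 = B3Ineq25RegularNested.derivFD C Ω Ω₂ A msq a k c := rfl

/-- **The kernel of `δG_k(Ω,Ω₂,A)` is symmetric**: `⟨w, (δG_kδ_{x′}v)(x)⟩ = ⟨(δG_kδ_xw)(x′), v⟩` (both region kernels are, p33 g58).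
[cite: Balaban1982Higgs1, (2.20) p.610] [cite: Balaban1983Higgs3, (1.16) p.414] -/
theorem inner_dG_single_comm (x x' : HiggsLattice.Site P 0) (v w : E N) :
    ⟪w, dG C Ω Ω₂ A msq a k (Pi.single x' v) x⟫_ℝ = ⟪dG C Ω Ω₂ A msq a k (Pi.single x w) x', v⟫_ℝ := by
  rw [dG, LinearMap.sub_apply, LinearMap.sub_apply, Pi.sub_apply, Pi.sub_apply, inner_sub_right, inner_sub_left,
    inner_propagatorK_single_comm_R, inner_propagatorK_single_comm_R]

/-- Hence `δG_k(x,y)^* = δG_k(y,x)` for the blocks. [cite: Balaban1982Higgs1, (2.20) p.610] -/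
theorem star_blockKD (x y : HiggsLattice.Site P 0) : star (blockKD C Ω Ω₂ A msq a k x y) = blockKD C Ω Ω₂ A msq a k y x := by
  rw [ContinuousLinearMap.star_eq_adjoint]
  refine ContinuousLinearMap.ext fun v => ?_
  refine ext_inner_right ℝ fun w => ?_
  rw [ContinuousLinearMap.adjoint_inner_left, blockKD_apply, blockKD_apply]
  exact inner_dG_single_comm x y w v

/-- and `F(x,y)^* = F(y,x)` in units. [cite: Balaban1982Higgs1, (2.20) p.610] -/
theorem star_kvD (x y : HiggsLattice.Site P 0) : star (kvD C Ω Ω₂ A msq a k x y) = kvD C Ω Ω₂ A msq a k y x := by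
  unfold kvD; rw [star_smul, star_trivial, star_blockKD]

/-- and `G(x,y)^* = h(x)h′(y)·F(y,x)`. [cite: Balaban1982Higgs1, (2.20) p.610] -/
theorem star_kerGD (h h' : HiggsLattice.Site P 0 → ℝ) (x y : HiggsLattice.Site P 0) :
    star (kerM (kvD C Ω Ω₂ A msq a k) h h' (x, y)) = (h x * h' y) • kvD C Ω Ω₂ A msq a k y x := by
  rw [kerM, star_smul, star_trivial, star_kvD]

/-- the derivative block in the print's units is `L^k` times the covariant difference of the value blocks (`unitD·ε^{−1} = L^k·unitV`).
[cite: Balaban1982Higgs1, (1.7) p.605] -/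
theorem kdD_eq (b : HiggsLattice.PBond P 0) (y : HiggsLattice.Site P 0) :
    kdD C Ω Ω₂ A msq a k b y
      = ((P.L : ℝ) ^ k) • ((C.U (P.mesh 0) (A b)).comp (kvD C Ω Ω₂ A msq a k b.tgt y) - kvD C Ω Ω₂ A msq a k b.src y) := by
  rw [kdD, blockDKD, smul_smul, unitD_mul_inv_mesh, ← smul_smul]
  simp only [kvD, ContinuousLinearMap.comp_smul]
  rw [smul_sub]

/-- **The product rule IS the covariant difference quotient, ROW bonds**: for the row bond `μ` over `(x,x′)`,
`derivM(c) = L^k·(U(εA_{⟨x,μ⟩})G(x+e_μ,x′) − G(x,x′))` (the `η`-covariant derivative `D^η_{A,μ}` of `x ↦ G(x,x′)`).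
[cite: Balaban1983Higgs3, (1.32) p.420] [cite: Balaban1982Higgs1, (1.7) p.605] -/
theorem derivGD_inl (h h' : HiggsLattice.Site P 0 → ℝ) (μ : Fin P.d) (x x' : HiggsLattice.Site P 0) :
    derivM k (kvD C Ω Ω₂ A msq a k) (kdD C Ω Ω₂ A msq a k) h h' (Sum.inl (μ, (x, x')))
      = ((P.L : ℝ) ^ k) • ((C.U (P.mesh 0) (A ⟨x, μ⟩)).comp (kerM (kvD C Ω Ω₂ A msq a k) h h' (x.shift μ, x'))
          - kerM (kvD C Ω Ω₂ A msq a k) h h' (x, x')) := by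
  rw [derivM_inl, kdD_eq]
  simp only [kerM, dEta, HiggsLattice.PBond.tgt]
  simp only [ContinuousLinearMap.comp_smul]
  module

/-- **The product rule IS the covariant difference quotient, COLUMN bonds**: for the column bond `ν` over `(x,x′)`,
`derivM(c) = L^k·(U(εA_{⟨x′,ν⟩})G(x,x′+e_ν)^* − G(x,x′)^*)` — the `η`-covariant derivative `D^η_{A,ν}` of the column slice `x′ ↦ G(x,x′)^*` (made an
equation by `star_kerGD`). [cite: Balaban1983Higgs3, (1.32) p.420] [cite: Balaban1982Higgs1, (2.20) p.610] -/
theorem derivGD_inr (h h' : HiggsLattice.Site P 0 → ℝ) (ν : Fin P.d) (x x' : HiggsLattice.Site P 0) :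
    derivM k (kvD C Ω Ω₂ A msq a k) (kdD C Ω Ω₂ A msq a k) h h' (Sum.inr (ν, (x, x')))
      = ((P.L : ℝ) ^ k) • ((C.U (P.mesh 0) (A ⟨x', ν⟩)).comp (star (kerM (kvD C Ω Ω₂ A msq a k) h h' (x, x'.shift ν)))
          - star (kerM (kvD C Ω Ω₂ A msq a k) h h' (x, x'))) := by
  rw [star_kerGD, star_kerGD, derivM_inr, kdD_eq]
  simp only [dEta, HiggsLattice.PBond.tgt]
  simp only [ContinuousLinearMap.comp_smul]
  module

end Blocks

/-! ## §2 Admissible localization domains, boxes of interior unit cubes, the lattice distance of two supports -/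

section Domains

variable {k K₀ r₀ m : ℕ} {Ω₂ : Finset (HiggsLattice.Site P 0)}

/-- **An admissible localization domain for `δG_k(Ω,Ω₂,A)`** at scale `k`: made of INTERIOR points of `Ω₂` (r14's `Interior k K₀ Ω₂`, the
`R₀`-clause of every kernel entry) at lattice distance `≥ r₀L^k` from `Ω₂ᶜ` (the margin of p33 g60's admissible cubes), closed under the coordinatewise
contours `cpath` between its points, and of diameter `≤ mL^k` — the properties of a box of `m^d` admissible unit cubes (`domD_of_box`).
[cite: Balaban1983Higgs3, (2.5) p.424, p.420] [cite: Balaban1982Higgs1, Prop. 2.1 p.610] -/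
structure DomD (k K₀ : ℕ) (Ω₂ : Finset (HiggsLattice.Site P 0)) (r₀ m : ℕ) (S : Finset (HiggsLattice.Site P 0)) : Prop where
  interior : ∀ x ∈ S, Interior k K₀ Ω₂ x
  margin : ∀ x ∈ S, (r₀ : ℝ) * (P.L : ℝ) ^ k ≤ distC Ω₂ x
  path : ∀ y₁ ∈ S, ∀ y₂ ∈ S, ∀ z ∈ y₁ :: cpath y₁ y₂, z ∈ S
  diam : ∀ y₁ ∈ S, ∀ y₂ ∈ S, (HiggsLattice.Site.tdist y₁ y₂ : ℝ) / (P.L : ℝ) ^ k ≤ m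

/-- **A box of `m` unit cubes a side made of admissible cubes is an admissible domain** (no wrap-around: `2mL^k ≤ |T_ε|_μ`).
[cite: Balaban1983Higgs3, p.420] [cite: Balaban1982Higgs1, Prop. 2.1 p.610] -/
theorem domD_of_box {lo : Fin P.d → ℕ} (hn : ∀ μ, 2 * (m * P.L ^ k) ≤ P.sitesPerDir 0 μ)
    (hS : ∀ x, InBox k lo m x → Interior k K₀ Ω₂ x ∧ (r₀ : ℝ) * (P.L : ℝ) ^ k ≤ distC Ω₂ x) :
    DomD k K₀ Ω₂ r₀ m (boxSet k lo m) where
  interior := fun x hx => (hS x (mem_boxSet.1 hx)).1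
  margin := fun x hx => (hS x (mem_boxSet.1 hx)).2
  path := fun _ h₁ _ h₂ z hz => mem_boxSet.2 (inBox_of_mem_cpath hn (mem_boxSet.1 h₁) (mem_boxSet.1 h₂) z hz)
  diam := fun _ h₁ _ h₂ => tdist_div_le_of_inBox (mem_boxSet.1 h₁) (mem_boxSet.1 h₂)

/-- **The lattice distance of two supports in the `η`-units**: `dist(S, S′) = min_{x ∈ S, x′ ∈ S′}|x − x′|/L^k` (`0` if a support is empty).
[cite: Balaban1983Higgs3, (2.5) p.424] -/
def setDist (k : ℕ) (S S' : Finset (HiggsLattice.Site P 0)) : ℝ :=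
  if hne : (S ×ˢ S').Nonempty then
    ((S ×ˢ S').inf' hne fun z => (HiggsLattice.Site.tdist z.1 z.2 : ℝ)) / (P.L : ℝ) ^ k
  else 0

/-- `dist(S, S′) ≥ 0`. [cite: Balaban1983Higgs3, (2.5) p.424] -/
theorem setDist_nonneg (k : ℕ) (S S' : Finset (HiggsLattice.Site P 0)) : 0 ≤ setDist k S S' := by
  unfold setDist
  split_ifs with hne
  · refine div_nonneg ?_ (pow_nonneg (Nat.cast_nonneg _) _)
    exact (Finset.le_inf'_iff hne _).2 fun w _ => Nat.cast_nonneg _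
  · exact le_rfl

/-- **every pair of points of the two supports is at least their distance apart**: `L^k·dist(S,S′) ≤ |x − x′|`. [cite: Balaban1983Higgs3, (2.5) p.424] -/
theorem pow_mul_setDist_le {S S' : Finset (HiggsLattice.Site P 0)} {x x' : HiggsLattice.Site P 0} (hx : x ∈ S) (hx' : x' ∈ S') :
    (P.L : ℝ) ^ k * setDist k S S' ≤ (HiggsLattice.Site.tdist x x' : ℝ) := by
  have hT : (0 : ℝ) < (P.L : ℝ) ^ k := pow_pos (by exact_mod_cast P.hL) k
  have hmem : (x, x') ∈ S ×ˢ S' := Finset.mem_product.2 ⟨hx, hx'⟩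
  have hne : (S ×ˢ S').Nonempty := ⟨(x, x'), hmem⟩
  have hinf : (S ×ˢ S').inf' hne (fun z => (HiggsLattice.Site.tdist z.1 z.2 : ℝ)) ≤ (HiggsLattice.Site.tdist x x' : ℝ) :=
    Finset.inf'_le (fun z : PSite P => (HiggsLattice.Site.tdist z.1 z.2 : ℝ)) hmem
  have e : setDist k S S' = (S ×ˢ S').inf' hne (fun z => (HiggsLattice.Site.tdist z.1 z.2 : ℝ)) / (P.L : ℝ) ^ k := by
    unfold setDist; rw [dif_pos hne]
  have h2 : setDist k S S' ≤ (HiggsLattice.Site.tdist x x' : ℝ) / (P.L : ℝ) ^ k := by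
    rw [e]; exact div_le_div_of_nonneg_right hinf hT.le
  rw [mul_comm]
  exact (le_div_iff₀ hT).1 h2

end Domains

/-! ## §3 The four bounds of `F = δG_k(Ω,Ω₂,A)` on a pair of admissible domains, from the four kernel entries AT SCALE `k` at interior points -/

section Parts

variable {k K₀ r₀ m : ℕ} {C : ChargeData N} {Ω Ω₂ : Finset (HiggsLattice.Site P 0)} {A : HiggsLattice.VecField P 0} {msq a : ℝ}
  {S S' : Finset (HiggsLattice.Site P 0)} {D : ℝ}

/-- kernel: a separation `L^kD ≤ |x − x′|` gives the decay factor `e^{−δ|x−x′|/L^k} ≤ e^{−δD}`. [cite: Balaban1983Higgs3, (2.5) p.424] -/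
private theorem exp_sep_le {x x' : HiggsLattice.Site P 0} {δ : ℝ} (hδ : 0 ≤ δ)
    (h : (P.L : ℝ) ^ k * D ≤ (HiggsLattice.Site.tdist x x' : ℝ)) :
    Real.exp (-(δ * ((HiggsLattice.Site.tdist x x' : ℝ) / (P.L : ℝ) ^ k))) ≤ Real.exp (-(δ * D)) :=
  exp_margin_le hδ (by rw [mul_comm]; exact h)

/-- kernel: the margin factor of two admissible points is below `e^{−δr₀}`. [cite: Balaban1983Higgs3, (2.5) p.424] -/
private theorem exp_margin_sum_le {x x' : HiggsLattice.Site P 0} {δ : ℝ} (hδ : 0 ≤ δ) (hx : (r₀ : ℝ) * (P.L : ℝ) ^ k ≤ distC Ω₂ x) :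
    Real.exp (-(δ * ((distC Ω₂ x + distC Ω₂ x') / (P.L : ℝ) ^ k))) ≤ Real.exp (-(δ * (r₀ : ℝ))) :=
  exp_margin_le hδ (hx.trans (le_add_of_nonneg_right (distC_nonneg _ _)))

/-- **Part 1 — the value blocks on `S × S′`**: `‖F(x,y)‖ ≤ C_V·e^{−δr₀}·e^{−δD}` for `x ∈ S`, `y ∈ S′`, from the value entry of the kernel of `δG_k` at
scale `k` at interior points. [cite: Balaban1983Higgs3, (2.5) p.424] -/
theorem sup_part_leDS {δ CV : ℝ} (hδ : 0 ≤ δ) (hCV : 0 ≤ CV)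
    (hV : ∀ (x x' : HiggsLattice.Site P 0), Interior k K₀ Ω₂ x → Interior k K₀ Ω₂ x' →
      (P.mesh 0 ^ P.d)⁻¹ * ∑ i' : Ix N, ‖dG C Ω Ω₂ A msq a k (cb P N 0 (x', i')) x‖
        ≤ CV * (P.mesh k ^ 2 * (P.mesh k ^ P.d)⁻¹) * Real.exp (-(δ * ((HiggsLattice.Site.tdist x x' : ℝ) / (P.L : ℝ) ^ k))) *
          Real.exp (-(δ * ((distC Ω₂ x + distC Ω₂ x') / (P.L : ℝ) ^ k))))
    (hdom : DomD k K₀ Ω₂ r₀ m S) (hdom' : DomD k K₀ Ω₂ r₀ m S')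
    (hsep : ∀ x ∈ S, ∀ x' ∈ S', (P.L : ℝ) ^ k * D ≤ (HiggsLattice.Site.tdist x x' : ℝ))
    {x y : HiggsLattice.Site P 0} (hx : x ∈ S) (hy : y ∈ S') :
    ‖kvD C Ω Ω₂ A msq a k x y‖ ≤ CV * Real.exp (-(δ * (r₀ : ℝ))) * Real.exp (-(δ * D)) := by
  have hmk := P.mesh_pos k
  have hU : 0 ≤ P.mesh k ^ P.d * (P.mesh k ^ 2)⁻¹ := by positivity
  have hid : P.mesh k ^ P.d * (P.mesh k ^ 2)⁻¹ * (P.mesh k ^ 2 * (P.mesh k ^ P.d)⁻¹) = 1 := by field_simp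
  have hE1 := exp_sep_le hδ (hsep x hx y hy)
  have hE2 := exp_margin_sum_le (Ω₂ := Ω₂) (x' := y) hδ (hdom.margin x hx)
  rw [kvD, norm_smul, Real.norm_eq_abs, abs_of_pos (unitV_pos P k)]
  calc unitV P k * ‖blockKD C Ω Ω₂ A msq a k x y‖
      ≤ unitV P k * ∑ i' : Ix N, ‖dG C Ω Ω₂ A msq a k (cb P N 0 (y, i')) x‖ :=
        mul_le_mul_of_nonneg_left (norm_blockKD_le x y) (unitV_pos P k).le
    _ = P.mesh k ^ P.d * (P.mesh k ^ 2)⁻¹ * ((P.mesh 0 ^ P.d)⁻¹ * ∑ i' : Ix N, ‖dG C Ω Ω₂ A msq a k (cb P N 0 (y, i')) x‖) := by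
        rw [unitV]; ring
    _ ≤ P.mesh k ^ P.d * (P.mesh k ^ 2)⁻¹ * (CV * (P.mesh k ^ 2 * (P.mesh k ^ P.d)⁻¹) *
          Real.exp (-(δ * D)) * Real.exp (-(δ * (r₀ : ℝ)))) :=
        mul_le_mul_of_nonneg_left ((hV x y (hdom.interior x hx) (hdom'.interior y hy)).trans
          (mul_le_mul (mul_le_mul_of_nonneg_left hE1 (by positivity)) hE2 (Real.exp_pos _).le (by positivity))) hU
    _ = CV * Real.exp (-(δ * (r₀ : ℝ))) * Real.exp (-(δ * D)) *
          (P.mesh k ^ P.d * (P.mesh k ^ 2)⁻¹ * (P.mesh k ^ 2 * (P.mesh k ^ P.d)⁻¹)) := by ring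
    _ = _ := by rw [hid, mul_one]

/-- **The raw derivative bound on a domain pair**: for a `T_ε`-bond with source in `S` and the other site in `S′`,
`(L^kε)^{d−1}ε^{−d}‖(DδG_k)(b, y)‖ ≤ C_D·e^{−δr₀}·e^{−δD}` (the target of `b` need not lie in `S`). [cite: Balaban1983Higgs3, (2.5) p.424, (1.32) p.420] -/
theorem deriv_raw_leDS {δ CD : ℝ} (hδ : 0 ≤ δ) (hCD : 0 ≤ CD)
    (hDv : ∀ (μ : Fin P.d) (x x' : HiggsLattice.Site P 0), Interior k K₀ Ω₂ x → Interior k K₀ Ω₂ x' →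
      (P.mesh 0 ^ P.d)⁻¹ * ∑ i' : Ix N, ‖covDeriv C A (dG C Ω Ω₂ A msq a k (cb P N 0 (x', i'))) ⟨x, μ⟩‖
        ≤ CD * (P.mesh k * (P.mesh k ^ P.d)⁻¹) * Real.exp (-(δ * ((HiggsLattice.Site.tdist x x' : ℝ) / (P.L : ℝ) ^ k))) *
          Real.exp (-(δ * ((distC Ω₂ x + distC Ω₂ x') / (P.L : ℝ) ^ k))))
    (hdom : DomD k K₀ Ω₂ r₀ m S) (hdom' : DomD k K₀ Ω₂ r₀ m S')
    (hsep : ∀ x ∈ S, ∀ x' ∈ S', (P.L : ℝ) ^ k * D ≤ (HiggsLattice.Site.tdist x x' : ℝ))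
    {x y : HiggsLattice.Site P 0} (hx : x ∈ S) (hy : y ∈ S') (μ : Fin P.d) :
    unitD P k * ‖blockDKD C Ω Ω₂ A msq a k ⟨x, μ⟩ y‖ ≤ CD * Real.exp (-(δ * (r₀ : ℝ))) * Real.exp (-(δ * D)) := by
  have hmk := P.mesh_pos k
  have hU : 0 ≤ P.mesh k ^ P.d * (P.mesh k)⁻¹ := by positivity
  have hid : P.mesh k ^ P.d * (P.mesh k)⁻¹ * (P.mesh k * (P.mesh k ^ P.d)⁻¹) = 1 := by field_simp
  have hE1 := exp_sep_le hδ (hsep x hx y hy)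
  have hE2 := exp_margin_sum_le (Ω₂ := Ω₂) (x' := y) hδ (hdom.margin x hx)
  calc unitD P k * ‖blockDKD C Ω Ω₂ A msq a k ⟨x, μ⟩ y‖
      ≤ unitD P k * ∑ i' : Ix N, ‖covDeriv C A (dG C Ω Ω₂ A msq a k (cb P N 0 (y, i'))) ⟨x, μ⟩‖ :=
        mul_le_mul_of_nonneg_left (norm_blockDKD_le _ y) (unitD_pos P k).le
    _ = P.mesh k ^ P.d * (P.mesh k)⁻¹ *
          ((P.mesh 0 ^ P.d)⁻¹ * ∑ i' : Ix N, ‖covDeriv C A (dG C Ω Ω₂ A msq a k (cb P N 0 (y, i'))) ⟨x, μ⟩‖) := by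
        rw [unitD]; ring
    _ ≤ P.mesh k ^ P.d * (P.mesh k)⁻¹ * (CD * (P.mesh k * (P.mesh k ^ P.d)⁻¹) *
          Real.exp (-(δ * D)) * Real.exp (-(δ * (r₀ : ℝ)))) :=
        mul_le_mul_of_nonneg_left ((hDv μ x y (hdom.interior x hx) (hdom'.interior y hy)).trans
          (mul_le_mul (mul_le_mul_of_nonneg_left hE1 (by positivity)) hE2 (Real.exp_pos _).le (by positivity))) hU
    _ = CD * Real.exp (-(δ * (r₀ : ℝ))) * Real.exp (-(δ * D)) *
          (P.mesh k ^ P.d * (P.mesh k)⁻¹ * (P.mesh k * (P.mesh k ^ P.d)⁻¹)) := by ring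
    _ = _ := by rw [hid, mul_one]

/-- **Part 2 — the derivative blocks**: `‖kdD ⟨x,μ⟩ y‖ ≤ C_D·e^{−δr₀}·e^{−δD}` for `x ∈ S`, `y ∈ S′`. [cite: Balaban1983Higgs3, (2.5) p.424, (1.32) p.420] -/
theorem deriv_part_leDS {δ CD : ℝ} (hδ : 0 ≤ δ) (hCD : 0 ≤ CD)
    (hDv : ∀ (μ : Fin P.d) (x x' : HiggsLattice.Site P 0), Interior k K₀ Ω₂ x → Interior k K₀ Ω₂ x' →
      (P.mesh 0 ^ P.d)⁻¹ * ∑ i' : Ix N, ‖covDeriv C A (dG C Ω Ω₂ A msq a k (cb P N 0 (x', i'))) ⟨x, μ⟩‖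
        ≤ CD * (P.mesh k * (P.mesh k ^ P.d)⁻¹) * Real.exp (-(δ * ((HiggsLattice.Site.tdist x x' : ℝ) / (P.L : ℝ) ^ k))) *
          Real.exp (-(δ * ((distC Ω₂ x + distC Ω₂ x') / (P.L : ℝ) ^ k))))
    (hdom : DomD k K₀ Ω₂ r₀ m S) (hdom' : DomD k K₀ Ω₂ r₀ m S')
    (hsep : ∀ x ∈ S, ∀ x' ∈ S', (P.L : ℝ) ^ k * D ≤ (HiggsLattice.Site.tdist x x' : ℝ))
    {x y : HiggsLattice.Site P 0} (hx : x ∈ S) (hy : y ∈ S') (μ : Fin P.d) :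
    ‖kdD C Ω Ω₂ A msq a k ⟨x, μ⟩ y‖ ≤ CD * Real.exp (-(δ * (r₀ : ℝ))) * Real.exp (-(δ * D)) := by
  rw [kdD, norm_smul, Real.norm_eq_abs, abs_of_pos (unitD_pos P k)]
  exact deriv_raw_leDS hδ hCD hDv hdom hdom' hsep hx hy μ

/-- **Part 3a — the column move** `(DδG_k)(b,y₂)∘U(A(Γ_{y₁,y₂}))^* − (DδG_k)(b,y₁)` for `b` with source in `S_b`, `y₁, y₂ ∈ S_y`: bounded by
`d|y₁−y₂|·M_×`, `M_× = ε^dε·C_M(L^kε)^{−d}e^{−δr₀}e^{−δD}` the bound of the mixed entry at scale `k` on the bonds of `S_y` (the contour stays in `S_y`).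
[cite: Balaban1983Higgs3, (1.32) p.420, (2.5) p.424] -/
theorem termA_leDS (hS : ∀ μ, 2 < P.sitesPerDir 0 μ) {δ CM : ℝ} (hδ : 0 ≤ δ) (hCM : 0 ≤ CM)
    (hM : ∀ (μ ν : Fin P.d) (x x' : HiggsLattice.Site P 0), Interior k K₀ Ω₂ x → Interior k K₀ Ω₂ x' →
      (P.mesh 0 ^ P.d)⁻¹ * ((P.mesh 0)⁻¹ *
          ∑ i : Ix N, ‖covDeriv C A (dG C Ω Ω₂ A msq a k (dip C A ⟨x', ν⟩ (onb N i))) ⟨x, μ⟩‖)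
        ≤ CM * (P.mesh k ^ P.d)⁻¹ * Real.exp (-(δ * ((HiggsLattice.Site.tdist x x' : ℝ) / (P.L : ℝ) ^ k))) *
          Real.exp (-(δ * ((distC Ω₂ x + distC Ω₂ x') / (P.L : ℝ) ^ k))))
    {Sb Sy : Finset (HiggsLattice.Site P 0)} (hdom : DomD k K₀ Ω₂ r₀ m Sb) (hdom' : DomD k K₀ Ω₂ r₀ m Sy)
    (hsep : ∀ x ∈ Sb, ∀ x' ∈ Sy, (P.L : ℝ) ^ k * D ≤ (HiggsLattice.Site.tdist x x' : ℝ))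
    {b : HiggsLattice.PBond P 0} (hbv : b.src ∈ Sb) {y₁ y₂ : HiggsLattice.Site P 0} (hy₁ : y₁ ∈ Sy) (hy₂ : y₂ ∈ Sy) :
    ‖(blockDKD C Ω Ω₂ A msq a k b y₂).comp (star (hol C A y₁ (cpath y₁ y₂))) - blockDKD C Ω Ω₂ A msq a k b y₁‖
      ≤ (P.d : ℝ) * (HiggsLattice.Site.tdist y₁ y₂ : ℝ) *
          (P.mesh 0 ^ P.d * P.mesh 0 * (CM * (P.mesh k ^ P.d)⁻¹ * Real.exp (-(δ * (r₀ : ℝ))) * Real.exp (-(δ * D)))) := by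
  classical
  obtain ⟨xb, ν⟩ := b
  replace hbv : xb ∈ Sb := hbv
  have hε : 0 ≤ P.mesh 0 ^ P.d * P.mesh 0 := by have := P.mesh_pos 0; positivity
  obtain ⟨Mx, hMx⟩ : ∃ Mx : ℝ, Mx = P.mesh 0 ^ P.d * P.mesh 0 *
      (CM * (P.mesh k ^ P.d)⁻¹ * Real.exp (-(δ * (r₀ : ℝ))) * Real.exp (-(δ * D))) := ⟨_, rfl⟩
  have hMx0 : 0 ≤ Mx := by rw [hMx]; have := P.mesh_pos k; positivity
  have hadm := isAdm_cpath y₁ y₂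
  have hD : ∀ (c : HiggsLattice.PBond P 0) (w : E N), c.src ∈ Sy → c.tgt ∈ Sy →
      ‖covDeriv C A (dG C Ω Ω₂ A msq a k (dip C A ⟨xb, ν⟩ w)) c‖ ≤ Mx * ‖w‖ := by
    intro c w hc _
    obtain ⟨xc, μ⟩ := c
    replace hc : xc ∈ Sy := hc
    have hE1 : Real.exp (-(δ * ((HiggsLattice.Site.tdist xc xb : ℝ) / (P.L : ℝ) ^ k))) ≤ Real.exp (-(δ * D)) := by
      refine exp_sep_le hδ ?_
      rw [tdist_comm]; exact hsep xb hbv xc hc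
    have hE2 := exp_margin_sum_le (Ω₂ := Ω₂) (x' := xb) hδ (hdom'.margin xc hc)
    have hε0 : P.mesh 0 ≠ 0 := (P.mesh_pos 0).ne'
    have hsum : ∑ i : Ix N, ‖covDeriv C A (dG C Ω Ω₂ A msq a k (dip C A ⟨xb, ν⟩ (onb N i))) ⟨xc, μ⟩‖
        = P.mesh 0 ^ P.d * P.mesh 0 * ((P.mesh 0 ^ P.d)⁻¹ * ((P.mesh 0)⁻¹ *
          ∑ i : Ix N, ‖covDeriv C A (dG C Ω Ω₂ A msq a k (dip C A ⟨xb, ν⟩ (onb N i))) ⟨xc, μ⟩‖)) := by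
      field_simp
    calc ‖covDeriv C A (dG C Ω Ω₂ A msq a k (dip C A ⟨xb, ν⟩ w)) ⟨xc, μ⟩‖
        ≤ ‖w‖ * ∑ i : Ix N, ‖covDeriv C A (dG C Ω Ω₂ A msq a k (dip C A ⟨xb, ν⟩ (onb N i))) ⟨xc, μ⟩‖ :=
          norm_covDeriv_dip_le_sum (dG C Ω Ω₂ A msq a k) _ _ w
      _ ≤ ‖w‖ * Mx := by
          refine mul_le_mul_of_nonneg_left ?_ (norm_nonneg _)
          rw [hsum, hMx]
          refine mul_le_mul_of_nonneg_left ((hM μ ν xc xb (hdom'.interior xc hc) (hdom.interior xb hbv)).trans ?_) hε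
          have := P.mesh_pos k
          exact mul_le_mul (mul_le_mul_of_nonneg_left hE1 (by positivity)) hE2 (Real.exp_pos _).le (by positivity) |>.trans
            (le_of_eq (by ring))
      _ = Mx * ‖w‖ := mul_comm _ _
  have h := norm_blockDKD_comp_star_sub_le (Ω := Ω) (Ω₂ := Ω₂) (msq := msq) (a := a) (k := k) hS ⟨xb, ν⟩ Sy hMx0 hD hadm.1
    (hdom'.path y₁ hy₁ y₂ hy₂)
  rw [pathEnd_cpath] at h
  rw [← hMx]
  exact h.trans (mul_le_mul_of_nonneg_right hadm.2.2 hMx0)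

/-- kernel: the Hölder weight identity `(ε|x₁−x₂|)^α·((L^kε)^α)^{−1} = (|x₁−x₂|/L^k)^α`. [cite: Balaban1983Higgs3, (2.11) p.426] -/
private theorem weight_top_eq (k : ℕ) {t α : ℝ} (ht : 0 ≤ t) :
    (P.mesh 0 * t) ^ α * (P.mesh k ^ α)⁻¹ = (t / (P.L : ℝ) ^ k) ^ α := by
  have hm0 : 0 < P.mesh 0 := P.mesh_pos 0
  have hmk : 0 < P.mesh k := P.mesh_pos k
  have e : t / (P.L : ℝ) ^ k = (P.mesh 0 * t) / P.mesh k := by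
    rw [mesh_eq_pow_mul P k]
    have hLk : (P.L : ℝ) ^ k ≠ 0 := (pow_pos (by exact_mod_cast P.hL) k).ne'
    field_simp
  rw [e, Real.div_rpow (by positivity) hmk.le, div_eq_mul_inv]

/-- **Part 3b — the row move** `U(A(Γ_{x₁,x₂}))(DδG_k)(⟨x₂,μ⟩,y) − (DδG_k)(⟨x₁,μ⟩,y)` in the print's units, `x₁, x₂ ∈ S_b`, `y ∈ S_y`: bounded by
`p^α·C_He^{−δr₀}e^{−δD}` for any `p ≥ |x₁−x₂|/L^k`, from the Hölder entry at scale `k` along `Γ_{x₁,x₂} = cpath`.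
[cite: Balaban1983Higgs3, (1.32) p.420, (2.5) p.424, (2.11) p.426] -/
theorem termB_leDS {α δ CH : ℝ} (hα0 : 0 ≤ α) (hδ : 0 ≤ δ) (hCH : 0 ≤ CH)
    (hH : ∀ (μ : Fin P.d) (x₁ x₂ x' : HiggsLattice.Site P 0) (Γ : List (HiggsLattice.Site P 0)),
      Interior k K₀ Ω₂ x₁ → Interior k K₀ Ω₂ x₂ → Interior k K₀ Ω₂ x' → x₁ ≠ x₂ → IsAdm x₁ x₂ Γ →
      (P.mesh 0 ^ P.d)⁻¹ * ∑ i' : Ix N, ‖hol C A x₁ Γ (covDeriv C A (dG C Ω Ω₂ A msq a k (cb P N 0 (x', i'))) ⟨x₂, μ⟩)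
          - covDeriv C A (dG C Ω Ω₂ A msq a k (cb P N 0 (x', i'))) ⟨x₁, μ⟩‖
        ≤ (P.mesh 0 * (HiggsLattice.Site.tdist x₁ x₂ : ℝ)) ^ α * (CH * (P.mesh k * (P.mesh k ^ P.d)⁻¹ * (P.mesh k ^ α)⁻¹)) *
          Real.exp (-(δ * (min (HiggsLattice.Site.tdist x₁ x' : ℝ) (HiggsLattice.Site.tdist x₂ x' : ℝ) / (P.L : ℝ) ^ k))) *
          Real.exp (-(δ * (min (min (distC Ω₂ x₁) (distC Ω₂ x₂)) (distC Ω₂ x') / (P.L : ℝ) ^ k))))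
    {Sb Sy : Finset (HiggsLattice.Site P 0)} (hdom : DomD k K₀ Ω₂ r₀ m Sb) (hdom' : DomD k K₀ Ω₂ r₀ m Sy)
    (hsep : ∀ x ∈ Sb, ∀ x' ∈ Sy, (P.L : ℝ) ^ k * D ≤ (HiggsLattice.Site.tdist x x' : ℝ))
    {x₁ x₂ y : HiggsLattice.Site P 0} (μ : Fin P.d) (hx₁ : x₁ ∈ Sb) (hx₂ : x₂ ∈ Sb) (hy : y ∈ Sy) {pd : ℝ}
    (hpd : (HiggsLattice.Site.tdist x₁ x₂ : ℝ) / (P.L : ℝ) ^ k ≤ pd) :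
    unitD P k * ‖(hol C A x₁ (cpath x₁ x₂)).comp (blockDKD C Ω Ω₂ A msq a k ⟨x₂, μ⟩ y) - blockDKD C Ω Ω₂ A msq a k ⟨x₁, μ⟩ y‖
      ≤ pd ^ α * (CH * Real.exp (-(δ * (r₀ : ℝ))) * Real.exp (-(δ * D))) := by
  have hL0 : (0 : ℝ) < P.L := by exact_mod_cast (lt_of_lt_of_le zero_lt_one P.hL)
  have hLk : (0 : ℝ) < (P.L : ℝ) ^ k := pow_pos hL0 k
  have hpd0 : 0 ≤ pd := le_trans (by positivity) hpd
  by_cases hx : x₁ = x₂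
  · subst hx
    rw [cpath_self, hol_nil, ContinuousLinearMap.one_def, ContinuousLinearMap.id_comp, sub_self, norm_zero, mul_zero]
    positivity
  have hmk := P.mesh_pos k
  have hm0 := P.mesh_pos 0
  have hU : 0 ≤ P.mesh k ^ P.d * (P.mesh k)⁻¹ := by positivity
  -- the two decay factors
  have hE1 : Real.exp (-(δ * (min (HiggsLattice.Site.tdist x₁ y : ℝ) (HiggsLattice.Site.tdist x₂ y : ℝ) / (P.L : ℝ) ^ k)))
      ≤ Real.exp (-(δ * D)) := by
    refine exp_dist_mono hδ ?_
    rw [le_div_iff₀ hLk, mul_comm]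
    exact le_min (hsep x₁ hx₁ y hy) (hsep x₂ hx₂ y hy)
  have hE2 : Real.exp (-(δ * (min (min (distC Ω₂ x₁) (distC Ω₂ x₂)) (distC Ω₂ y) / (P.L : ℝ) ^ k))) ≤ Real.exp (-(δ * (r₀ : ℝ))) :=
    exp_margin_le hδ (le_min (le_min (hdom.margin x₁ hx₁) (hdom.margin x₂ hx₂)) (hdom'.margin y hy))
  -- the weight
  have ht0 : 0 ≤ (HiggsLattice.Site.tdist x₁ x₂ : ℝ) := Nat.cast_nonneg _
  have hwt : (P.mesh 0 * (HiggsLattice.Site.tdist x₁ x₂ : ℝ)) ^ α * (P.mesh k ^ α)⁻¹ ≤ pd ^ α := by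
    rw [weight_top_eq k ht0]
    exact Real.rpow_le_rpow (by positivity) hpd hα0
  have hid : P.mesh k ^ P.d * (P.mesh k)⁻¹ * (P.mesh k * (P.mesh k ^ P.d)⁻¹) = 1 := by field_simp
  calc unitD P k * ‖(hol C A x₁ (cpath x₁ x₂)).comp (blockDKD C Ω Ω₂ A msq a k ⟨x₂, μ⟩ y) - blockDKD C Ω Ω₂ A msq a k ⟨x₁, μ⟩ y‖
      ≤ unitD P k * ∑ i' : Ix N, ‖hol C A x₁ (cpath x₁ x₂) (covDeriv C A (dG C Ω Ω₂ A msq a k (cb P N 0 (y, i'))) ⟨x₂, μ⟩)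
          - covDeriv C A (dG C Ω Ω₂ A msq a k (cb P N 0 (y, i'))) ⟨x₁, μ⟩‖ :=
        mul_le_mul_of_nonneg_left (norm_hol_comp_blockDKD_sub_le x₁ x₂ y _ μ) (unitD_pos P k).le
    _ = P.mesh k ^ P.d * (P.mesh k)⁻¹ * ((P.mesh 0 ^ P.d)⁻¹ * ∑ i' : Ix N,
          ‖hol C A x₁ (cpath x₁ x₂) (covDeriv C A (dG C Ω Ω₂ A msq a k (cb P N 0 (y, i'))) ⟨x₂, μ⟩)
            - covDeriv C A (dG C Ω Ω₂ A msq a k (cb P N 0 (y, i'))) ⟨x₁, μ⟩‖) := by rw [unitD]; ring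
    _ ≤ P.mesh k ^ P.d * (P.mesh k)⁻¹ * ((P.mesh 0 * (HiggsLattice.Site.tdist x₁ x₂ : ℝ)) ^ α *
          (CH * (P.mesh k * (P.mesh k ^ P.d)⁻¹ * (P.mesh k ^ α)⁻¹)) *
          Real.exp (-(δ * D)) * Real.exp (-(δ * (r₀ : ℝ)))) := by
        refine mul_le_mul_of_nonneg_left ((hH μ x₁ x₂ y _ (hdom.interior x₁ hx₁) (hdom.interior x₂ hx₂) (hdom'.interior y hy) hx
          (isAdm_cpath x₁ x₂)).trans ?_) hU
        have h0 : 0 ≤ (P.mesh 0 * (HiggsLattice.Site.tdist x₁ x₂ : ℝ)) ^ α * (CH * (P.mesh k * (P.mesh k ^ P.d)⁻¹ * (P.mesh k ^ α)⁻¹)) := by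
          have : 0 ≤ (P.mesh 0 * (HiggsLattice.Site.tdist x₁ x₂ : ℝ)) ^ α := Real.rpow_nonneg (by positivity) _
          have : 0 < P.mesh k ^ α := Real.rpow_pos_of_pos hmk α
          positivity
        exact mul_le_mul (mul_le_mul_of_nonneg_left hE1 h0) hE2 (Real.exp_pos _).le (mul_nonneg h0 (Real.exp_pos _).le)
    _ = ((P.mesh 0 * (HiggsLattice.Site.tdist x₁ x₂ : ℝ)) ^ α * (P.mesh k ^ α)⁻¹) *
          (CH * Real.exp (-(δ * (r₀ : ℝ))) * Real.exp (-(δ * D))) *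
          (P.mesh k ^ P.d * (P.mesh k)⁻¹ * (P.mesh k * (P.mesh k ^ P.d)⁻¹)) := by ring
    _ ≤ pd ^ α * (CH * Real.exp (-(δ * (r₀ : ℝ))) * Real.exp (-(δ * D))) := by
        rw [hid, mul_one]; exact mul_le_mul_of_nonneg_right hwt (by positivity)

/-- inside a domain of diameter `≤ m`: `p ≤ m·p^α` for `0 < p ≤ m`, `0 ≤ α ≤ 1`, `m ≥ 1`. [folklore] -/
private theorem le_mul_rpow_of_le {p α : ℝ} {m : ℕ} (hp : 0 < p) (hpm : p ≤ m) (hα0 : 0 ≤ α) (hα1 : α ≤ 1) : p ≤ m * p ^ α := by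
  have hm1 : (1 : ℝ) ≤ m := by
    have : (0 : ℝ) < m := hp.trans_le hpm
    exact_mod_cast Nat.one_le_iff_ne_zero.mpr (by rintro rfl; simp at this)
  have e : p = p ^ α * p ^ (1 - α) := by
    rw [← Real.rpow_add hp, add_sub_cancel, Real.rpow_one]
  have h1 : p ^ (1 - α) ≤ (m : ℝ) ^ (1 - α) := Real.rpow_le_rpow hp.le hpm (by linarith)
  have h2 : (m : ℝ) ^ (1 - α) ≤ (m : ℝ) ^ (1 : ℝ) := Real.rpow_le_rpow_of_exponent_le hm1 (by linarith)
  rw [Real.rpow_one] at h2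
  calc p = p ^ α * p ^ (1 - α) := e
    _ ≤ p ^ α * m := mul_le_mul_of_nonneg_left (h1.trans h2) (Real.rpow_nonneg hp.le _)
    _ = m * p ^ α := mul_comm _ _

/-- **Part 3 — the transported Hölder differences of the derivative blocks, one same-direction pair in explicit variables**: bonds `⟨x₁,μ⟩, ⟨x₂,μ⟩`
over `S_b`, other sites `y₁, y₂ ∈ S_y`: `‖U(A(Γ_{x₁,x₂}))kdD(⟨x₂,μ⟩,y₂)U(A(Γ_{y₁,y₂}))^* − kdD(⟨x₁,μ⟩,y₁)‖ ≤ (C_H + dmC_M)e^{−δr₀}e^{−δD}·p^α`,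
`p = max(|x₁−x₂|,|y₁−y₂|)/L^k > 0` — triangle through `(⟨x₂,μ⟩,y₁)`: column move (Part 3a, `|y₁−y₂|/L^k ≤ p ≤ mp^α` inside a domain of diameter
`m`) plus row move (Part 3b). [cite: Balaban1983Higgs3, (2.5) p.424, (1.32) p.420] -/
theorem holder_coreDS (hS : ∀ μ, 2 < P.sitesPerDir 0 μ) {α δ CH CM : ℝ} (hα0 : 0 ≤ α) (hα1 : α ≤ 1) (hδ : 0 ≤ δ)
    (hCH : 0 ≤ CH) (hCM : 0 ≤ CM)
    (hH : ∀ (μ : Fin P.d) (x₁ x₂ x' : HiggsLattice.Site P 0) (Γ : List (HiggsLattice.Site P 0)),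
      Interior k K₀ Ω₂ x₁ → Interior k K₀ Ω₂ x₂ → Interior k K₀ Ω₂ x' → x₁ ≠ x₂ → IsAdm x₁ x₂ Γ →
      (P.mesh 0 ^ P.d)⁻¹ * ∑ i' : Ix N, ‖hol C A x₁ Γ (covDeriv C A (dG C Ω Ω₂ A msq a k (cb P N 0 (x', i'))) ⟨x₂, μ⟩)
          - covDeriv C A (dG C Ω Ω₂ A msq a k (cb P N 0 (x', i'))) ⟨x₁, μ⟩‖
        ≤ (P.mesh 0 * (HiggsLattice.Site.tdist x₁ x₂ : ℝ)) ^ α * (CH * (P.mesh k * (P.mesh k ^ P.d)⁻¹ * (P.mesh k ^ α)⁻¹)) *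
          Real.exp (-(δ * (min (HiggsLattice.Site.tdist x₁ x' : ℝ) (HiggsLattice.Site.tdist x₂ x' : ℝ) / (P.L : ℝ) ^ k))) *
          Real.exp (-(δ * (min (min (distC Ω₂ x₁) (distC Ω₂ x₂)) (distC Ω₂ x') / (P.L : ℝ) ^ k))))
    (hM : ∀ (μ ν : Fin P.d) (x x' : HiggsLattice.Site P 0), Interior k K₀ Ω₂ x → Interior k K₀ Ω₂ x' →
      (P.mesh 0 ^ P.d)⁻¹ * ((P.mesh 0)⁻¹ *
          ∑ i : Ix N, ‖covDeriv C A (dG C Ω Ω₂ A msq a k (dip C A ⟨x', ν⟩ (onb N i))) ⟨x, μ⟩‖)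
        ≤ CM * (P.mesh k ^ P.d)⁻¹ * Real.exp (-(δ * ((HiggsLattice.Site.tdist x x' : ℝ) / (P.L : ℝ) ^ k))) *
          Real.exp (-(δ * ((distC Ω₂ x + distC Ω₂ x') / (P.L : ℝ) ^ k))))
    {Sb Sy : Finset (HiggsLattice.Site P 0)} (hdom : DomD k K₀ Ω₂ r₀ m Sb) (hdom' : DomD k K₀ Ω₂ r₀ m Sy)
    (hsep : ∀ x ∈ Sb, ∀ x' ∈ Sy, (P.L : ℝ) ^ k * D ≤ (HiggsLattice.Site.tdist x x' : ℝ))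
    {x₁ x₂ y₁ y₂ : HiggsLattice.Site P 0} (μ : Fin P.d) (hx₁ : x₁ ∈ Sb) (hx₂ : x₂ ∈ Sb) (hy₁ : y₁ ∈ Sy) (hy₂ : y₂ ∈ Sy)
    (hpos : 0 < max (HiggsLattice.Site.tdist x₁ x₂ : ℝ) (HiggsLattice.Site.tdist y₁ y₂ : ℝ) / (P.L : ℝ) ^ k) :
    ‖(hol C A x₁ (cpath x₁ x₂)).comp ((kdD C Ω Ω₂ A msq a k ⟨x₂, μ⟩ y₂).comp (star (hol C A y₁ (cpath y₁ y₂))))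
        - kdD C Ω Ω₂ A msq a k ⟨x₁, μ⟩ y₁‖
      ≤ (CH + P.d * m * CM) * Real.exp (-(δ * (r₀ : ℝ))) * Real.exp (-(δ * D)) *
          (max (HiggsLattice.Site.tdist x₁ x₂ : ℝ) (HiggsLattice.Site.tdist y₁ y₂ : ℝ) / (P.L : ℝ) ^ k) ^ α := by
  have hL0 : (0 : ℝ) < P.L := by exact_mod_cast (lt_of_lt_of_le zero_lt_one P.hL)
  have hLk : (0 : ℝ) < (P.L : ℝ) ^ k := pow_pos hL0 k
  obtain ⟨pd, hpd⟩ : ∃ pd : ℝ,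
      pd = max (HiggsLattice.Site.tdist x₁ x₂ : ℝ) (HiggsLattice.Site.tdist y₁ y₂ : ℝ) / (P.L : ℝ) ^ k := ⟨_, rfl⟩
  rw [← hpd] at hpos ⊢
  have htb : (HiggsLattice.Site.tdist x₁ x₂ : ℝ) / (P.L : ℝ) ^ k ≤ pd := by
    rw [hpd]; exact div_le_div_of_nonneg_right (le_max_left _ _) hLk.le
  have hty : (HiggsLattice.Site.tdist y₁ y₂ : ℝ) / (P.L : ℝ) ^ k ≤ pd := by
    rw [hpd]; exact div_le_div_of_nonneg_right (le_max_right _ _) hLk.le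
  have hpdm : pd ≤ m := by
    rw [hpd, ← max_div_div_right hLk.le]
    exact max_le (hdom.diam x₁ hx₁ x₂ hx₂) (hdom'.diam y₁ hy₁ y₂ hy₂)
  have hpdα : pd ≤ m * pd ^ α := le_mul_rpow_of_le hpos hpdm hα0 hα1
  unfold kdD
  have e : (hol C A x₁ (cpath x₁ x₂)).comp
          ((unitD P k • blockDKD C Ω Ω₂ A msq a k ⟨x₂, μ⟩ y₂).comp (star (hol C A y₁ (cpath y₁ y₂))))
        - unitD P k • blockDKD C Ω Ω₂ A msq a k ⟨x₁, μ⟩ y₁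
      = unitD P k • ((hol C A x₁ (cpath x₁ x₂)).comp
          ((blockDKD C Ω Ω₂ A msq a k ⟨x₂, μ⟩ y₂).comp (star (hol C A y₁ (cpath y₁ y₂))) - blockDKD C Ω Ω₂ A msq a k ⟨x₂, μ⟩ y₁) +
        ((hol C A x₁ (cpath x₁ x₂)).comp (blockDKD C Ω Ω₂ A msq a k ⟨x₂, μ⟩ y₁) - blockDKD C Ω Ω₂ A msq a k ⟨x₁, μ⟩ y₁)) := by
    rw [ContinuousLinearMap.smul_comp, ContinuousLinearMap.comp_smul, ContinuousLinearMap.comp_sub, sub_add_sub_cancel,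
      smul_sub]
  rw [e, norm_smul, Real.norm_eq_abs, abs_of_pos (unitD_pos P k)]
  have hA := termA_leDS (Ω := Ω) (msq := msq) (a := a) hS hδ hCM hM hdom hdom' hsep (b := ⟨x₂, μ⟩) hx₂ hy₁ hy₂
  have hB := termB_leDS (Ω := Ω) (msq := msq) (a := a) hα0 hδ hCH hH hdom hdom' hsep μ hx₁ hx₂ hy₁ htb
  have hu : unitD P k * (P.mesh 0 ^ P.d * P.mesh 0) * (P.mesh k ^ P.d)⁻¹ = ((P.L : ℝ) ^ k)⁻¹ := by
    unfold unitD
    rw [mesh_eq_pow_mul P k]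
    have hε0 : P.mesh 0 ≠ 0 := (P.mesh_pos 0).ne'
    have hLk0 : (P.L : ℝ) ^ k ≠ 0 := hLk.ne'
    field_simp
  obtain ⟨TA, hTA⟩ : ∃ T : E N →L[ℝ] E N,
      (blockDKD C Ω Ω₂ A msq a k ⟨x₂, μ⟩ y₂).comp (star (hol C A y₁ (cpath y₁ y₂))) - blockDKD C Ω Ω₂ A msq a k ⟨x₂, μ⟩ y₁ = T :=
    ⟨_, rfl⟩
  obtain ⟨TB, hTB⟩ : ∃ T : E N →L[ℝ] E N,
      (hol C A x₁ (cpath x₁ x₂)).comp (blockDKD C Ω Ω₂ A msq a k ⟨x₂, μ⟩ y₁) - blockDKD C Ω Ω₂ A msq a k ⟨x₁, μ⟩ y₁ = T := ⟨_, rfl⟩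
  rw [hTA] at hA ⊢
  rw [hTB] at hB ⊢
  have hu0 := (unitD_pos P k).le
  have hX : ‖(hol C A x₁ (cpath x₁ x₂)).comp TA‖ ≤ ‖TA‖ := norm_hol_comp_le _ _ _
  have hK0 : 0 ≤ CM * Real.exp (-(δ * (r₀ : ℝ))) * Real.exp (-(δ * D)) := by positivity
  calc unitD P k * ‖(hol C A x₁ (cpath x₁ x₂)).comp TA + TB‖
      ≤ unitD P k * (‖TA‖ + ‖TB‖) := mul_le_mul_of_nonneg_left ((norm_add_le _ _).trans (add_le_add hX le_rfl)) hu0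
    _ = unitD P k * ‖TA‖ + unitD P k * ‖TB‖ := mul_add _ _ _
    _ ≤ unitD P k * ((P.d : ℝ) * (HiggsLattice.Site.tdist y₁ y₂ : ℝ) * (P.mesh 0 ^ P.d * P.mesh 0 *
            (CM * (P.mesh k ^ P.d)⁻¹ * Real.exp (-(δ * (r₀ : ℝ))) * Real.exp (-(δ * D))))) +
          pd ^ α * (CH * Real.exp (-(δ * (r₀ : ℝ))) * Real.exp (-(δ * D))) :=
        add_le_add (mul_le_mul_of_nonneg_left hA hu0) hB
    _ = (P.d : ℝ) * ((HiggsLattice.Site.tdist y₁ y₂ : ℝ) * (unitD P k * (P.mesh 0 ^ P.d * P.mesh 0) * (P.mesh k ^ P.d)⁻¹)) *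
            (CM * Real.exp (-(δ * (r₀ : ℝ))) * Real.exp (-(δ * D))) +
          pd ^ α * (CH * Real.exp (-(δ * (r₀ : ℝ))) * Real.exp (-(δ * D))) := by ring
    _ = (P.d : ℝ) * ((HiggsLattice.Site.tdist y₁ y₂ : ℝ) / (P.L : ℝ) ^ k) *
            (CM * Real.exp (-(δ * (r₀ : ℝ))) * Real.exp (-(δ * D))) +
          pd ^ α * (CH * Real.exp (-(δ * (r₀ : ℝ))) * Real.exp (-(δ * D))) := by
        rw [hu]; ring
    _ ≤ (P.d : ℝ) * (m * pd ^ α) * (CM * Real.exp (-(δ * (r₀ : ℝ))) * Real.exp (-(δ * D))) +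
          pd ^ α * (CH * Real.exp (-(δ * (r₀ : ℝ))) * Real.exp (-(δ * D))) :=
        add_le_add (mul_le_mul_of_nonneg_right
          (mul_le_mul_of_nonneg_left (hty.trans hpdα) (Nat.cast_nonneg _)) hK0) le_rfl
    _ = _ := by ring

/-! ### The value-Lipschitz clause: `F` at two base points of `S × S′`, transported -/

/-- **An operator norm from its bilinear form**: `|⟨w, Xv⟩| ≤ B‖v‖‖w‖` for all `v, w` gives `‖X‖ ≤ B`. [folklore] -/
private theorem opNorm_le_of_inner_le (X : E N →L[ℝ] E N) {B : ℝ} (hB : 0 ≤ B) (h : ∀ v w : E N, |⟪w, X v⟫_ℝ| ≤ B * ‖v‖ * ‖w‖) :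
    ‖X‖ ≤ B := by
  refine ContinuousLinearMap.opNorm_le_bound _ hB fun v => ?_
  have h1 := h v (X v)
  rw [real_inner_self_eq_norm_sq, abs_of_nonneg (sq_nonneg _)] at h1
  by_cases h0 : ‖X v‖ = 0
  · rw [h0]; positivity
  · have hpos : 0 < ‖X v‖ := lt_of_le_of_ne (norm_nonneg _) (Ne.symm h0)
    nlinarith

/-- **The row move of VALUES**: for a chain `Γ` from `x₁` inside a set `S_b` on whose bonds `‖(DδG_k)(b, y)‖ ≤ M` for the fixed other site `y`,
`‖U(A(Γ))δG_k(end Γ,y) − δG_k(x₁,y)‖ ≤ ε|Γ|M` (p35's path lemma on the column field `δG_kδ_yv`). [cite: Balaban1983Higgs3, (1.32) p.420]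
[cite: Balaban1983RegularityDecay, p.578] -/
theorem norm_hol_comp_blockKD_sub_le (hS : ∀ μ, 2 < P.sitesPerDir 0 μ) (y : HiggsLattice.Site P 0)
    (Sb : Finset (HiggsLattice.Site P 0)) {Mx : ℝ} (hMx : 0 ≤ Mx)
    (hD : ∀ (b : HiggsLattice.PBond P 0), b.src ∈ Sb → b.tgt ∈ Sb → ‖blockDKD C Ω Ω₂ A msq a k b y‖ ≤ Mx)
    {x₁ : HiggsLattice.Site P 0} {Γ : List (HiggsLattice.Site P 0)} (hch : IsTChain x₁ Γ) (hΓ : ∀ z ∈ x₁ :: Γ, z ∈ Sb) :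
    ‖(hol C A x₁ Γ).comp (blockKD C Ω Ω₂ A msq a k (pathEnd x₁ Γ) y) - blockKD C Ω Ω₂ A msq a k x₁ y‖ ≤ P.mesh 0 * Γ.length * Mx := by
  have hε : 0 < P.mesh 0 := P.mesh_pos 0
  refine ContinuousLinearMap.opNorm_le_bound _ (by positivity) fun v => ?_
  set φ : ScalarField P 0 N := dG C Ω Ω₂ A msq a k (Pi.single y v) with hφ
  rw [_root_.sub_apply, ContinuousLinearMap.comp_apply, blockKD_apply, blockKD_apply]
  have hpath := norm_hol_apply_sub_le hS C A φ Sb (G := Mx * ‖v‖)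
    (fun z μ hz hzμ => by
      rw [hφ, ← blockDKD_apply]
      exact (ContinuousLinearMap.le_opNorm _ _).trans (mul_le_mul_of_nonneg_right (hD ⟨z, μ⟩ hz hzμ) (norm_nonneg _)))
    hch hΓ
  calc ‖hol C A x₁ Γ (φ (pathEnd x₁ Γ)) - φ x₁‖ ≤ P.mesh 0 * Γ.length * (Mx * ‖v‖) := hpath
    _ = P.mesh 0 * Γ.length * Mx * ‖v‖ := by ring

/-- **The column move of VALUES**: for a chain `Γ′` from `y₁` inside a set `S_y` on whose bonds `‖(DδG_k)(b′, x)‖ ≤ M′` for the fixed row site `x`,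
`‖δG_k(x,end Γ′)∘U(A(Γ′))^* − δG_k(x,y₁)‖ ≤ ε|Γ′|M′` — the symmetry of the kernel turns it into the row move of the column field `δG_kδ_xw`.
[cite: Balaban1983Higgs3, (1.32) p.420] [cite: Balaban1982Higgs1, (2.20) p.610] -/
theorem norm_blockKD_comp_star_sub_le (hS : ∀ μ, 2 < P.sitesPerDir 0 μ) (x : HiggsLattice.Site P 0)
    (Sy : Finset (HiggsLattice.Site P 0)) {Mx : ℝ} (hMx : 0 ≤ Mx)
    (hD : ∀ (b : HiggsLattice.PBond P 0), b.src ∈ Sy → b.tgt ∈ Sy → ‖blockDKD C Ω Ω₂ A msq a k b x‖ ≤ Mx)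
    {y₁ : HiggsLattice.Site P 0} {Γ' : List (HiggsLattice.Site P 0)} (hch : IsTChain y₁ Γ') (hΓ : ∀ z ∈ y₁ :: Γ', z ∈ Sy) :
    ‖(blockKD C Ω Ω₂ A msq a k x (pathEnd y₁ Γ')).comp (star (hol C A y₁ Γ')) - blockKD C Ω Ω₂ A msq a k x y₁‖
      ≤ P.mesh 0 * Γ'.length * Mx := by
  have hε : 0 < P.mesh 0 := P.mesh_pos 0
  refine opNorm_le_of_inner_le _ (by positivity) fun v w => ?_
  set ψ : ScalarField P 0 N := dG C Ω Ω₂ A msq a k (Pi.single x w) with hψ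
  have hform : ⟪w, ((blockKD C Ω Ω₂ A msq a k x (pathEnd y₁ Γ')).comp (star (hol C A y₁ Γ'))
      - blockKD C Ω Ω₂ A msq a k x y₁) v⟫_ℝ = ⟪hol C A y₁ Γ' (ψ (pathEnd y₁ Γ')) - ψ y₁, v⟫_ℝ := by
    rw [_root_.sub_apply, ContinuousLinearMap.comp_apply, inner_sub_right, blockKD_apply, blockKD_apply,
      inner_dG_single_comm, inner_dG_single_comm, ContinuousLinearMap.star_eq_adjoint,
      ContinuousLinearMap.adjoint_inner_right, inner_sub_left]
  rw [hform]
  have hpath := norm_hol_apply_sub_le hS C A ψ Sy (G := Mx * ‖w‖)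
    (fun z μ hz hzμ => by
      rw [hψ, ← blockDKD_apply]
      exact (ContinuousLinearMap.le_opNorm _ _).trans (mul_le_mul_of_nonneg_right (hD ⟨z, μ⟩ hz hzμ) (norm_nonneg _)))
    hch hΓ
  calc |⟪hol C A y₁ Γ' (ψ (pathEnd y₁ Γ')) - ψ y₁, v⟫_ℝ|
      ≤ ‖hol C A y₁ Γ' (ψ (pathEnd y₁ Γ')) - ψ y₁‖ * ‖v‖ := abs_real_inner_le_norm _ _
    _ ≤ P.mesh 0 * Γ'.length * (Mx * ‖w‖) * ‖v‖ := mul_le_mul_of_nonneg_right hpath (norm_nonneg _)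
    _ = _ := by ring

/-- **Part 4 — the value-Lipschitz clause on a domain pair, one same-direction pair in explicit variables**: `x₁, x₂ ∈ S_b`, `y₁, y₂ ∈ S_y`:
`‖U(A(Γ_{x₁,x₂}))F(x₂,y₂)U(A(Γ_{y₁,y₂}))^* − F(x₁,y₁)‖ ≤ d(|x₁−x₂| + |y₁−y₂|)/L^k · C_De^{−δr₀}e^{−δD}` — column move inside `S_y` plus row move inside
`S_b`, each `η`-step one derivative of `F` (`unitV·ε = unitD/L^k`). [cite: Balaban1983Higgs3, (1.32) p.420, (2.5) p.424] -/
theorem value_move_leDS (hS : ∀ μ, 2 < P.sitesPerDir 0 μ) {δ CD : ℝ} (hδ : 0 ≤ δ) (hCD : 0 ≤ CD)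
    (hDv : ∀ (μ : Fin P.d) (x x' : HiggsLattice.Site P 0), Interior k K₀ Ω₂ x → Interior k K₀ Ω₂ x' →
      (P.mesh 0 ^ P.d)⁻¹ * ∑ i' : Ix N, ‖covDeriv C A (dG C Ω Ω₂ A msq a k (cb P N 0 (x', i'))) ⟨x, μ⟩‖
        ≤ CD * (P.mesh k * (P.mesh k ^ P.d)⁻¹) * Real.exp (-(δ * ((HiggsLattice.Site.tdist x x' : ℝ) / (P.L : ℝ) ^ k))) *
          Real.exp (-(δ * ((distC Ω₂ x + distC Ω₂ x') / (P.L : ℝ) ^ k))))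
    {Sb Sy : Finset (HiggsLattice.Site P 0)} (hdom : DomD k K₀ Ω₂ r₀ m Sb) (hdom' : DomD k K₀ Ω₂ r₀ m Sy)
    (hsep : ∀ x ∈ Sb, ∀ x' ∈ Sy, (P.L : ℝ) ^ k * D ≤ (HiggsLattice.Site.tdist x x' : ℝ))
    {x₁ x₂ y₁ y₂ : HiggsLattice.Site P 0} (hx₁ : x₁ ∈ Sb) (hx₂ : x₂ ∈ Sb) (hy₁ : y₁ ∈ Sy) (hy₂ : y₂ ∈ Sy) :
    ‖(hol C A x₁ (cpath x₁ x₂)).comp ((kvD C Ω Ω₂ A msq a k x₂ y₂).comp (star (hol C A y₁ (cpath y₁ y₂))))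
        - kvD C Ω Ω₂ A msq a k x₁ y₁‖
      ≤ (P.d : ℝ) * (((HiggsLattice.Site.tdist x₁ x₂ : ℝ) + (HiggsLattice.Site.tdist y₁ y₂ : ℝ)) / (P.L : ℝ) ^ k) *
          (CD * Real.exp (-(δ * (r₀ : ℝ))) * Real.exp (-(δ * D))) := by
  have hL0 : (0 : ℝ) < P.L := by exact_mod_cast (lt_of_lt_of_le zero_lt_one P.hL)
  have hLk : (0 : ℝ) < (P.L : ℝ) ^ k := pow_pos hL0 k
  set B : ℝ := CD * Real.exp (-(δ * (r₀ : ℝ))) * Real.exp (-(δ * D)) with hB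
  have hB0 : 0 ≤ B := by positivity
  have hsep' : ∀ x ∈ Sy, ∀ x' ∈ Sb, (P.L : ℝ) ^ k * D ≤ (HiggsLattice.Site.tdist x x' : ℝ) := by
    intro x hx x' hx'; rw [tdist_comm]; exact hsep x' hx' x hx
  -- the derivative bound on the bonds of the two domains, raw form `‖blockDKD‖ ≤ B/unitD`
  have hMx0 : 0 ≤ B / unitD P k := div_nonneg hB0 (unitD_pos P k).le
  have hrow : ∀ (b : HiggsLattice.PBond P 0), b.src ∈ Sb → b.tgt ∈ Sb → ‖blockDKD C Ω Ω₂ A msq a k b y₁‖ ≤ B / unitD P k := by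
    intro b hb _
    obtain ⟨x, μ⟩ := b
    rw [le_div_iff₀ (unitD_pos P k), mul_comm]
    exact deriv_raw_leDS hδ hCD hDv hdom hdom' hsep hb hy₁ μ
  have hcol : ∀ (b : HiggsLattice.PBond P 0), b.src ∈ Sy → b.tgt ∈ Sy → ‖blockDKD C Ω Ω₂ A msq a k b x₂‖ ≤ B / unitD P k := by
    intro b hb _
    obtain ⟨y, μ⟩ := b
    rw [le_div_iff₀ (unitD_pos P k), mul_comm]
    exact deriv_raw_leDS hδ hCD hDv hdom' hdom hsep' hb hx₂ μ
  have hadmx := isAdm_cpath x₁ x₂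
  have hadmy := isAdm_cpath y₁ y₂
  -- the two moves
  have hA := norm_blockKD_comp_star_sub_le (C := C) (Ω := Ω) (Ω₂ := Ω₂) (A := A) (msq := msq) (a := a) (k := k) hS x₂ Sy hMx0 hcol
    hadmy.1 (hdom'.path y₁ hy₁ y₂ hy₂)
  have hBm := norm_hol_comp_blockKD_sub_le (C := C) (Ω := Ω) (Ω₂ := Ω₂) (A := A) (msq := msq) (a := a) (k := k) hS y₁ Sb hMx0 hrow
    hadmx.1 (hdom.path x₁ hx₁ x₂ hx₂)
  rw [pathEnd_cpath] at hA hBm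
  -- the unit out, the triangle through `F(x₂,y₁)`
  unfold kvD
  have e : (hol C A x₁ (cpath x₁ x₂)).comp
          ((unitV P k • blockKD C Ω Ω₂ A msq a k x₂ y₂).comp (star (hol C A y₁ (cpath y₁ y₂))))
        - unitV P k • blockKD C Ω Ω₂ A msq a k x₁ y₁
      = unitV P k • ((hol C A x₁ (cpath x₁ x₂)).comp
          ((blockKD C Ω Ω₂ A msq a k x₂ y₂).comp (star (hol C A y₁ (cpath y₁ y₂))) - blockKD C Ω Ω₂ A msq a k x₂ y₁) +
        ((hol C A x₁ (cpath x₁ x₂)).comp (blockKD C Ω Ω₂ A msq a k x₂ y₁) - blockKD C Ω Ω₂ A msq a k x₁ y₁)) := by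
    rw [ContinuousLinearMap.smul_comp, ContinuousLinearMap.comp_smul, ContinuousLinearMap.comp_sub, sub_add_sub_cancel,
      smul_sub]
  rw [e, norm_smul, Real.norm_eq_abs, abs_of_pos (unitV_pos P k)]
  obtain ⟨TA, hTA⟩ : ∃ T : E N →L[ℝ] E N,
      (blockKD C Ω Ω₂ A msq a k x₂ y₂).comp (star (hol C A y₁ (cpath y₁ y₂))) - blockKD C Ω Ω₂ A msq a k x₂ y₁ = T := ⟨_, rfl⟩
  obtain ⟨TB, hTB⟩ : ∃ T : E N →L[ℝ] E N,
      (hol C A x₁ (cpath x₁ x₂)).comp (blockKD C Ω Ω₂ A msq a k x₂ y₁) - blockKD C Ω Ω₂ A msq a k x₁ y₁ = T := ⟨_, rfl⟩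
  rw [hTA] at hA ⊢
  rw [hTB] at hBm ⊢
  have hX : ‖(hol C A x₁ (cpath x₁ x₂)).comp TA‖ ≤ ‖TA‖ := norm_hol_comp_le _ _ _
  have hu : unitV P k * P.mesh 0 * (B / unitD P k) = ((P.L : ℝ) ^ k)⁻¹ * B := by
    rw [unitV_mul_mesh]
    have hD0 : unitD P k ≠ 0 := (unitD_pos P k).ne'
    field_simp
  calc unitV P k * ‖(hol C A x₁ (cpath x₁ x₂)).comp TA + TB‖
      ≤ unitV P k * (‖TA‖ + ‖TB‖) :=
        mul_le_mul_of_nonneg_left ((norm_add_le _ _).trans (add_le_add hX le_rfl)) (unitV_pos P k).le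
    _ ≤ unitV P k * (P.mesh 0 * (cpath y₁ y₂).length * (B / unitD P k) + P.mesh 0 * (cpath x₁ x₂).length * (B / unitD P k)) :=
        mul_le_mul_of_nonneg_left (add_le_add hA hBm) (unitV_pos P k).le
    _ = unitV P k * P.mesh 0 * (B / unitD P k) * ((cpath y₁ y₂).length + (cpath x₁ x₂).length) := by ring
    _ = ((P.L : ℝ) ^ k)⁻¹ * B * ((cpath y₁ y₂).length + (cpath x₁ x₂).length) := by rw [hu]
    _ ≤ ((P.L : ℝ) ^ k)⁻¹ * B *
          ((P.d : ℝ) * (HiggsLattice.Site.tdist y₁ y₂ : ℝ) + (P.d : ℝ) * (HiggsLattice.Site.tdist x₁ x₂ : ℝ)) :=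
        mul_le_mul_of_nonneg_left (add_le_add hadmy.2.2 hadmx.2.2) (by positivity)
    _ = _ := by rw [hB]; field_simp; ring

/-- **The four bounds of `F = δG_k(Ω,Ω₂,A)` on a pair of admissible domains, packed** (Parts 1–4) with `B = (C_V + C_D)e^{−δr₀}e^{−δD}`,
`B_H = (C_H + dmC_M)e^{−δr₀}e^{−δD}`, in the hypothesis shapes of the generic multiplier `normM_le`. [cite: Balaban1983Higgs3, (2.5) p.424, (1.32) p.420] -/
theorem bounds_packDS (hS : ∀ μ, 2 < P.sitesPerDir 0 μ) {α δ CV CD CH CM : ℝ} (hα0 : 0 ≤ α) (hα1 : α ≤ 1) (hδ : 0 ≤ δ)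
    (hCV : 0 ≤ CV) (hCD : 0 ≤ CD) (hCH : 0 ≤ CH) (hCM : 0 ≤ CM)
    (hV : ∀ (x x' : HiggsLattice.Site P 0), Interior k K₀ Ω₂ x → Interior k K₀ Ω₂ x' →
      (P.mesh 0 ^ P.d)⁻¹ * ∑ i' : Ix N, ‖dG C Ω Ω₂ A msq a k (cb P N 0 (x', i')) x‖
        ≤ CV * (P.mesh k ^ 2 * (P.mesh k ^ P.d)⁻¹) * Real.exp (-(δ * ((HiggsLattice.Site.tdist x x' : ℝ) / (P.L : ℝ) ^ k))) *
          Real.exp (-(δ * ((distC Ω₂ x + distC Ω₂ x') / (P.L : ℝ) ^ k))))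
    (hDv : ∀ (μ : Fin P.d) (x x' : HiggsLattice.Site P 0), Interior k K₀ Ω₂ x → Interior k K₀ Ω₂ x' →
      (P.mesh 0 ^ P.d)⁻¹ * ∑ i' : Ix N, ‖covDeriv C A (dG C Ω Ω₂ A msq a k (cb P N 0 (x', i'))) ⟨x, μ⟩‖
        ≤ CD * (P.mesh k * (P.mesh k ^ P.d)⁻¹) * Real.exp (-(δ * ((HiggsLattice.Site.tdist x x' : ℝ) / (P.L : ℝ) ^ k))) *
          Real.exp (-(δ * ((distC Ω₂ x + distC Ω₂ x') / (P.L : ℝ) ^ k))))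
    (hH : ∀ (μ : Fin P.d) (x₁ x₂ x' : HiggsLattice.Site P 0) (Γ : List (HiggsLattice.Site P 0)),
      Interior k K₀ Ω₂ x₁ → Interior k K₀ Ω₂ x₂ → Interior k K₀ Ω₂ x' → x₁ ≠ x₂ → IsAdm x₁ x₂ Γ →
      (P.mesh 0 ^ P.d)⁻¹ * ∑ i' : Ix N, ‖hol C A x₁ Γ (covDeriv C A (dG C Ω Ω₂ A msq a k (cb P N 0 (x', i'))) ⟨x₂, μ⟩)
          - covDeriv C A (dG C Ω Ω₂ A msq a k (cb P N 0 (x', i'))) ⟨x₁, μ⟩‖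
        ≤ (P.mesh 0 * (HiggsLattice.Site.tdist x₁ x₂ : ℝ)) ^ α * (CH * (P.mesh k * (P.mesh k ^ P.d)⁻¹ * (P.mesh k ^ α)⁻¹)) *
          Real.exp (-(δ * (min (HiggsLattice.Site.tdist x₁ x' : ℝ) (HiggsLattice.Site.tdist x₂ x' : ℝ) / (P.L : ℝ) ^ k))) *
          Real.exp (-(δ * (min (min (distC Ω₂ x₁) (distC Ω₂ x₂)) (distC Ω₂ x') / (P.L : ℝ) ^ k))))
    (hM : ∀ (μ ν : Fin P.d) (x x' : HiggsLattice.Site P 0), Interior k K₀ Ω₂ x → Interior k K₀ Ω₂ x' →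
      (P.mesh 0 ^ P.d)⁻¹ * ((P.mesh 0)⁻¹ *
          ∑ i : Ix N, ‖covDeriv C A (dG C Ω Ω₂ A msq a k (dip C A ⟨x', ν⟩ (onb N i))) ⟨x, μ⟩‖)
        ≤ CM * (P.mesh k ^ P.d)⁻¹ * Real.exp (-(δ * ((HiggsLattice.Site.tdist x x' : ℝ) / (P.L : ℝ) ^ k))) *
          Real.exp (-(δ * ((distC Ω₂ x + distC Ω₂ x') / (P.L : ℝ) ^ k))))
    {Sb Sy : Finset (HiggsLattice.Site P 0)} (hdom : DomD k K₀ Ω₂ r₀ m Sb) (hdom' : DomD k K₀ Ω₂ r₀ m Sy) (hD0 : 0 ≤ D)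
    (hsep : ∀ x ∈ Sb, ∀ x' ∈ Sy, (P.L : ℝ) ^ k * D ≤ (HiggsLattice.Site.tdist x x' : ℝ)) :
    (∀ x ∈ Sb, ∀ y ∈ Sy, ‖kvD C Ω Ω₂ A msq a k x y‖ ≤ (CV + CD) * Real.exp (-(δ * (r₀ : ℝ))) * Real.exp (-(δ * D))) ∧
    (∀ x ∈ Sb, ∀ y ∈ Sy, ∀ μ : Fin P.d,
      ‖kdD C Ω Ω₂ A msq a k ⟨x, μ⟩ y‖ ≤ (CV + CD) * Real.exp (-(δ * (r₀ : ℝ))) * Real.exp (-(δ * D))) ∧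
    (∀ (μ : Fin P.d) (x₁ x₂ y₁ y₂ : HiggsLattice.Site P 0), x₁ ∈ Sb → x₂ ∈ Sb → y₁ ∈ Sy → y₂ ∈ Sy →
      0 < max (HiggsLattice.Site.tdist x₁ x₂ : ℝ) (HiggsLattice.Site.tdist y₁ y₂ : ℝ) / (P.L : ℝ) ^ k →
      ‖(hol C A x₁ (cpath x₁ x₂)).comp ((kdD C Ω Ω₂ A msq a k ⟨x₂, μ⟩ y₂).comp (star (hol C A y₁ (cpath y₁ y₂))))
          - kdD C Ω Ω₂ A msq a k ⟨x₁, μ⟩ y₁‖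
        ≤ (CH + P.d * m * CM) * Real.exp (-(δ * (r₀ : ℝ))) * Real.exp (-(δ * D)) *
            (max (HiggsLattice.Site.tdist x₁ x₂ : ℝ) (HiggsLattice.Site.tdist y₁ y₂ : ℝ) / (P.L : ℝ) ^ k) ^ α) ∧
    (∀ (x₁ x₂ y₁ y₂ : HiggsLattice.Site P 0), x₁ ∈ Sb → x₂ ∈ Sb → y₁ ∈ Sy → y₂ ∈ Sy →
      ‖(hol C A x₁ (cpath x₁ x₂)).comp ((kvD C Ω Ω₂ A msq a k x₂ y₂).comp (star (hol C A y₁ (cpath y₁ y₂))))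
          - kvD C Ω Ω₂ A msq a k x₁ y₁‖
        ≤ (P.d : ℝ) * (((HiggsLattice.Site.tdist x₁ x₂ : ℝ) + (HiggsLattice.Site.tdist y₁ y₂ : ℝ)) / (P.L : ℝ) ^ k) *
            ((CV + CD) * Real.exp (-(δ * (r₀ : ℝ))) * Real.exp (-(δ * D)))) := by
  have _ := hD0
  have hE : 0 ≤ Real.exp (-(δ * (r₀ : ℝ))) * Real.exp (-(δ * D)) := by positivity
  refine ⟨fun x hx y hy => ?_, fun x hx y hy μ => ?_, fun μ x₁ x₂ y₁ y₂ hx₁ hx₂ hy₁ hy₂ hpos => ?_,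
    fun x₁ x₂ y₁ y₂ hx₁ hx₂ hy₁ hy₂ => ?_⟩
  · calc ‖kvD C Ω Ω₂ A msq a k x y‖ ≤ CV * Real.exp (-(δ * (r₀ : ℝ))) * Real.exp (-(δ * D)) :=
          sup_part_leDS hδ hCV hV hdom hdom' hsep hx hy
      _ ≤ (CV + CD) * Real.exp (-(δ * (r₀ : ℝ))) * Real.exp (-(δ * D)) := by
          rw [mul_assoc, mul_assoc]; exact mul_le_mul_of_nonneg_right (by linarith) hE
  · calc ‖kdD C Ω Ω₂ A msq a k ⟨x, μ⟩ y‖ ≤ CD * Real.exp (-(δ * (r₀ : ℝ))) * Real.exp (-(δ * D)) :=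
          deriv_part_leDS hδ hCD hDv hdom hdom' hsep hx hy μ
      _ ≤ (CV + CD) * Real.exp (-(δ * (r₀ : ℝ))) * Real.exp (-(δ * D)) := by
          rw [mul_assoc, mul_assoc]; exact mul_le_mul_of_nonneg_right (by linarith) hE
  · exact holder_coreDS hS hα0 hα1 hδ hCH hCM hH hM hdom hdom' hsep μ hx₁ hx₂ hy₁ hy₂ hpos
  · have h := value_move_leDS (C := C) (Ω := Ω) (A := A) (msq := msq) (a := a) hS hδ hCD hDv hdom hdom' hsep hx₁ hx₂ hy₁ hy₂
    refine h.trans (mul_le_mul_of_nonneg_left ?_ (by positivity))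
    rw [mul_assoc, mul_assoc]; exact mul_le_mul_of_nonneg_right (by linarith) hE

end Parts

/-! ## §4 `‖hδG_k(Ω,Ω₂,A)h′‖_{1,α}` for smooth localization functions on a pair of admissible domains -/

section Smooth

variable {k K₀ r₀ m : ℕ} {C : ChargeData N} {Ω Ω₂ : Finset (HiggsLattice.Site P 0)} {A : HiggsLattice.VecField P 0} {msq a : ℝ}
  {S S' : Finset (HiggsLattice.Site P 0)} {D : ℝ}

/-- **`‖hδG_k(Ω,Ω₂,A)h′‖_{1,α} ≤ (K(c₁,c₂+2c₁,d,m)(C_V + C_D) + C_H + dmC_M)·e^{−δr₀}·e^{−δD}` ON THE WHOLE PRODUCT LATTICE** for localization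
functions `h, h′` of p40's class at exponent `1` supported (with collar) in a pair of admissible domains `S, S′` at lattice distance `≥ DL^k`
(`D ≥ 0`; no separation needed), given the four kernel entries of `δG_k(Ω,Ω₂,A)` at scale `k` at interior points of `Ω₂` with a common rate `δ`
— the generic multiplier `normM_le` on the four bounds of §3 for `(S,S′)` and for `(S′,S)`. [cite: Balaban1983Higgs3, (2.5) p.424, (1.32) p.420, p.420] -/
theorem normHGHDS_le (hS : ∀ μ, 2 < P.sitesPerDir 0 μ) {α δ CV CD CH CM c₁ c₂ : ℝ} (hα0 : 0 ≤ α) (hα1 : α ≤ 1) (hδ : 0 ≤ δ)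
    (hCV : 0 ≤ CV) (hCD : 0 ≤ CD) (hCH : 0 ≤ CH) (hCM : 0 ≤ CM) (hc₁ : 0 ≤ c₁) (hc₂ : 0 ≤ c₂)
    (hV : ∀ (x x' : HiggsLattice.Site P 0), Interior k K₀ Ω₂ x → Interior k K₀ Ω₂ x' →
      (P.mesh 0 ^ P.d)⁻¹ * ∑ i' : Ix N, ‖dG C Ω Ω₂ A msq a k (cb P N 0 (x', i')) x‖
        ≤ CV * (P.mesh k ^ 2 * (P.mesh k ^ P.d)⁻¹) * Real.exp (-(δ * ((HiggsLattice.Site.tdist x x' : ℝ) / (P.L : ℝ) ^ k))) *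
          Real.exp (-(δ * ((distC Ω₂ x + distC Ω₂ x') / (P.L : ℝ) ^ k))))
    (hDv : ∀ (μ : Fin P.d) (x x' : HiggsLattice.Site P 0), Interior k K₀ Ω₂ x → Interior k K₀ Ω₂ x' →
      (P.mesh 0 ^ P.d)⁻¹ * ∑ i' : Ix N, ‖covDeriv C A (dG C Ω Ω₂ A msq a k (cb P N 0 (x', i'))) ⟨x, μ⟩‖
        ≤ CD * (P.mesh k * (P.mesh k ^ P.d)⁻¹) * Real.exp (-(δ * ((HiggsLattice.Site.tdist x x' : ℝ) / (P.L : ℝ) ^ k))) *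
          Real.exp (-(δ * ((distC Ω₂ x + distC Ω₂ x') / (P.L : ℝ) ^ k))))
    (hH : ∀ (μ : Fin P.d) (x₁ x₂ x' : HiggsLattice.Site P 0) (Γ : List (HiggsLattice.Site P 0)),
      Interior k K₀ Ω₂ x₁ → Interior k K₀ Ω₂ x₂ → Interior k K₀ Ω₂ x' → x₁ ≠ x₂ → IsAdm x₁ x₂ Γ →
      (P.mesh 0 ^ P.d)⁻¹ * ∑ i' : Ix N, ‖hol C A x₁ Γ (covDeriv C A (dG C Ω Ω₂ A msq a k (cb P N 0 (x', i'))) ⟨x₂, μ⟩)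
          - covDeriv C A (dG C Ω Ω₂ A msq a k (cb P N 0 (x', i'))) ⟨x₁, μ⟩‖
        ≤ (P.mesh 0 * (HiggsLattice.Site.tdist x₁ x₂ : ℝ)) ^ α * (CH * (P.mesh k * (P.mesh k ^ P.d)⁻¹ * (P.mesh k ^ α)⁻¹)) *
          Real.exp (-(δ * (min (HiggsLattice.Site.tdist x₁ x' : ℝ) (HiggsLattice.Site.tdist x₂ x' : ℝ) / (P.L : ℝ) ^ k))) *
          Real.exp (-(δ * (min (min (distC Ω₂ x₁) (distC Ω₂ x₂)) (distC Ω₂ x') / (P.L : ℝ) ^ k))))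
    (hM : ∀ (μ ν : Fin P.d) (x x' : HiggsLattice.Site P 0), Interior k K₀ Ω₂ x → Interior k K₀ Ω₂ x' →
      (P.mesh 0 ^ P.d)⁻¹ * ((P.mesh 0)⁻¹ *
          ∑ i : Ix N, ‖covDeriv C A (dG C Ω Ω₂ A msq a k (dip C A ⟨x', ν⟩ (onb N i))) ⟨x, μ⟩‖)
        ≤ CM * (P.mesh k ^ P.d)⁻¹ * Real.exp (-(δ * ((HiggsLattice.Site.tdist x x' : ℝ) / (P.L : ℝ) ^ k))) *
          Real.exp (-(δ * ((distC Ω₂ x + distC Ω₂ x') / (P.L : ℝ) ^ k))))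
    (hdom : DomD k K₀ Ω₂ r₀ m S) (hdom' : DomD k K₀ Ω₂ r₀ m S') (hD0 : 0 ≤ D)
    (hsep : ∀ x ∈ S, ∀ x' ∈ S', (P.L : ℝ) ^ k * D ≤ (HiggsLattice.Site.tdist x x' : ℝ))
    {h h' : HiggsLattice.Site P 0 → ℝ} (hh : IsSmoothLoc k c₁ c₂ 1 S h) (hh' : IsSmoothLoc k c₁ c₂ 1 S' h') :
    normHGHDS C Ω Ω₂ A msq a k α h h'
      ≤ (smoothConst P.d m c₁ (c₂ + 2 * c₁) * (CV + CD) + (CH + P.d * m * CM)) * Real.exp (-(δ * (r₀ : ℝ))) * Real.exp (-(δ * D)) := by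
  have hsep' : ∀ x ∈ S', ∀ x' ∈ S, (P.L : ℝ) ^ k * D ≤ (HiggsLattice.Site.tdist x x' : ℝ) := by
    intro x hx x' hx'; rw [tdist_comm]; exact hsep x' hx' x hx
  obtain ⟨bY, bX, bH, bM⟩ := bounds_packDS hS hα0 hα1 hδ hCV hCD hCH hCM hV hDv hH hM hdom hdom' hD0 hsep
  obtain ⟨bY', bX', bH', bM'⟩ := bounds_packDS hS hα0 hα1 hδ hCV hCD hCH hCM hV hDv hH hM hdom' hdom hD0 hsep'
  have hhα := isSmoothLoc_of_lip hc₁ hc₂ hα0 hα1 hh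
  have hhα' := isSmoothLoc_of_lip hc₁ hc₂ hα0 hα1 hh'
  have hBV : 0 ≤ (CV + CD) * Real.exp (-(δ * (r₀ : ℝ))) * Real.exp (-(δ * D)) := by positivity
  have hBH : 0 ≤ (CH + P.d * m * CM) * Real.exp (-(δ * (r₀ : ℝ))) * Real.exp (-(δ * D)) := by positivity
  have hmain := normM_le (C := C) (A := A) (k := k) (m := m) (KV := kvD C Ω Ω₂ A msq a k) (KD := kdD C Ω Ω₂ A msq a k) hdom.diam hdom'.diam
    hc₁ (by positivity : 0 ≤ c₂ + 2 * c₁) hα0 hα1 hhα hhα' hBV hBH bY bX bH bM bY' bX' bH' bM'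
  rw [normHGHDS]
  refine hmain.trans (le_of_eq ?_)
  ring

end Smooth

/-! ## §5 The carrier of (2.5) with SMOOTH localization functions, the transfer from the four kernel entries, and the hypothesis-free plug -/

section Carrier

variable {k K₀ r₀ m : ℕ} {Ω₂ : Finset (HiggsLattice.Site P 0)}

/-- **A smooth localization function of p. 420 for `δG_k(Ω,Ω₂,A)`**: a bump `fn` of p40's class at exponent `1` with constants `c₁, c₂` (`|h| ≤ 1`,
`|∂^ηh| ≤ c₁`, `∂^ηh` `c₂`-Lipschitz in the `η`-units), supported with its lattice collar in an admissible domain `supp` (interior points of `Ω₂` at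
margin `≥ r₀L^k`, contour-closed, diameter `≤ mL^k` — e.g. a box of `m^d` admissible unit cubes, `SmoothLocFn.ofBox`; `m = 2`: the «cube with sides
of length 2» of the vector-leg partitions of unity; `m = 3`: «h = 1 on □(v) and h = 0 outside some neighborhood of □(v)» with the neighbourhood in the
ring of adjacent cubes). [cite: Balaban1983Higgs3, p.420] [cite: Balaban1983Higgs3, (2.5) p.424] -/
structure SmoothLocFn (k K₀ : ℕ) (Ω₂ : Finset (HiggsLattice.Site P 0)) (r₀ m : ℕ) (c₁ c₂ : ℝ) where
  /-- the support domain `S` (the bump and its lattice collar vanish outside) -/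
  supp : Finset (HiggsLattice.Site P 0)
  /-- the localization function `h : T_η → ℝ` -/
  fn : HiggsLattice.Site P 0 → ℝ
  /-- `S` is an admissible domain -/
  dom : DomD k K₀ Ω₂ r₀ m supp
  /-- `h` is a smooth bump supported with collar in `S` -/
  smooth : IsSmoothLoc k c₁ c₂ 1 supp fn

/-- **The bumps of a box of admissible unit cubes** (`m` cubes a side, no wrap-around `2mL^k ≤ |T_ε|_μ`, all points interior in `Ω₂` at margin
`≥ r₀L^k`) are localization functions of the carrier. [cite: Balaban1983Higgs3, p.420] -/
def SmoothLocFn.ofBox {c₁ c₂ : ℝ} (lo : Fin P.d → ℕ) (hn : ∀ μ, 2 * (m * P.L ^ k) ≤ P.sitesPerDir 0 μ)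
    (hS : ∀ x, InBox k lo m x → Interior k K₀ Ω₂ x ∧ (r₀ : ℝ) * (P.L : ℝ) ^ k ≤ distC Ω₂ x)
    {h : HiggsLattice.Site P 0 → ℝ} (hh : IsSmoothLoc k c₁ c₂ 1 (boxSet k lo m) h) : SmoothLocFn k K₀ Ω₂ r₀ m c₁ c₂ where
  supp := boxSet k lo m
  fn := h
  dom := domD_of_box hn hS
  smooth := hh

/-- the bump of `SmoothLocFn.ofBox` is the given one. [cite: Balaban1983Higgs3, p.420] -/
theorem SmoothLocFn.ofBox_fn {c₁ c₂ : ℝ} (lo : Fin P.d → ℕ) (hn : ∀ μ, 2 * (m * P.L ^ k) ≤ P.sitesPerDir 0 μ)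
    (hS : ∀ x, InBox k lo m x → Interior k K₀ Ω₂ x ∧ (r₀ : ℝ) * (P.L : ℝ) ^ k ≤ distC Ω₂ x)
    {h : HiggsLattice.Site P 0 → ℝ} (hh : IsSmoothLoc k c₁ c₂ 1 (boxSet k lo m) h) :
    (SmoothLocFn.ofBox lo hn hS hh).fn = h := rfl

variable (C : ChargeData N) (Ω Ω₂ : Finset (HiggsLattice.Site P 0)) (A : HiggsLattice.VecField P 0) (msq a : ℝ) (k)

/-- **The concrete carrier of B3 (2.5) WITH SMOOTH LOCALIZATION FUNCTIONS for NESTED REGIONS `Ω₂ ⊆ Ω ⊂ T_η` at a REGULAR NON-CONSTANT background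
`B̃ = A`**, scale `k`, cube parameter `K₀`, margin `r₀`, support size `m`, bump constants `c₁, c₂`: r14's `regRegionKernels` for `Ω₂` (its (2.10)
fields) EXTENDED by the (2.5) data — `LocFn` = the smooth bumps on admissible domains (`SmoothLocFn`), `distSupp h h′` = the lattice distance of the two
support domains in `η`-units (`setDist`), `distΩ₂ := r₀` (G-B3-14 reading), `normDeltaG α h h′ = ‖hδG_k(Ω,Ω₂,A)h′‖_{1,α}` on the whole product lattice
(`normHGHDS`); the (1.16) alternative is NOT modelled (`norm116 := 0`), nor are the (2.11)/(2.12) fields.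
[cite: Balaban1983Higgs3, (2.5) p.424, (1.16) p.414, p.420] -/
def sect2DeltaSmooth (hL1 : 1 < P.L) (C : ChargeData N) (Ω Ω₂ : Finset (HiggsLattice.Site P 0)) (A : HiggsLattice.VecField P 0)
    (msq a : ℝ) (k K₀ r₀ m : ℕ) (c₁ c₂ : ℝ) : ScaledKernels :=
  { regRegionKernels hL1 C Ω₂ A msq a k K₀ with
    LocFn := SmoothLocFn k K₀ Ω₂ r₀ m c₁ c₂
    distSupp := fun f f' => setDist k f.supp f'.supp
    distΩ₂ := (r₀ : ℝ)
    normDeltaG := fun α f f' => normHGHDS C Ω Ω₂ A msq a k α f.fn f'.fn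
    norm116 := fun _ _ _ _ _ => 0 }

variable {C Ω Ω₂ A msq a k}

/-- `(2.5)` for the smooth carrier unfolds to: the bound on `normHGHDS` for every pair of smooth localization functions (first conjunct), and the
trivially true (1.16) clause (not modelled). [cite: Balaban1983Higgs3, (2.5) p.424] -/
theorem ineq25_smooth_iff {hL1 : 1 < P.L} {K₀ r₀ m : ℕ} {c₁ c₂ : ℝ} (α δ₀ Cst : ℝ) :
    (sect2DeltaSmooth hL1 C Ω Ω₂ A msq a k K₀ r₀ m c₁ c₂).Ineq25 α δ₀ Cst ↔
      (∀ f f' : SmoothLocFn k K₀ Ω₂ r₀ m c₁ c₂,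
        normHGHDS C Ω Ω₂ A msq a k α f.fn f'.fn
          ≤ Cst * Real.exp (-(δ₀ * (r₀ : ℝ))) * Real.exp (-(δ₀ * setDist k f.supp f'.supp))) ∧
      (∀ (n n' : ℕ) (_f _f' : SmoothLocFn k K₀ Ω₂ r₀ m c₁ c₂),
        (0 : ℝ) ≤ Cst * ((0 : ℝ) * 0) ^ (n + n') * Real.exp (-(δ₀ * setDist k _f.supp _f'.supp))) :=
  Iff.rfl

/-- The (2.10) clause for the smooth carrier IS r14's region statement for `Ω₂` (same fields). [cite: Balaban1983Higgs3, (2.10) p.426] -/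
theorem ineq210_smooth_iff_R {hL1 : 1 < P.L} {K₀ r₀ m : ℕ} {c₁ c₂ : ℝ} (δ₁ Cst : ℝ) :
    (sect2DeltaSmooth hL1 C Ω Ω₂ A msq a k K₀ r₀ m c₁ c₂).Ineq210 δ₁ Cst ↔ (regRegionKernels hL1 C Ω₂ A msq a k K₀).Ineq210 δ₁ Cst :=
  Iff.rfl

set_option maxHeartbeats 1600000 in
/-- **Transfer**: the four kernel entries of `δG_k(Ω,Ω₂,A)` at scale `k` in the model's units at interior points of `Ω₂` — value, row derivative,
transported Hölder difference, mixed second derivative, with the rates `δ₁, …, δ₄` and the boundary factors — give **(2.5) for the SMOOTH carrier**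
`sect2DeltaSmooth … r₀ m c₁ c₂` with `δ₀ = min δᵢ` and `O(1) = K(c₁,c₂+2c₁,d,m)(C_V + C_D) + C_H + dmC_M`, for EVERY margin `r₀`, support size `m`, bump
constants `c₁, c₂ ≥ 0`, every `0 ≤ α ≤ 1`, every volume with `K ≥ 1`, `L ≥ 2`. [cite: Balaban1983Higgs3, (2.5) p.424, (1.32) p.420, p.420] -/
theorem ineq25_smooth_of_bounds {hL1 : 1 < P.L} {c₁ c₂ : ℝ} (hL2 : 2 ≤ P.L) (hk1 : 1 ≤ k) (hkK : k ≤ P.K)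
    {α δ₁ δ₂ δ₃ δ₄ CV CD CH CM : ℝ} (hα0 : 0 ≤ α) (hα1 : α ≤ 1) (hc₁ : 0 ≤ c₁) (hc₂ : 0 ≤ c₂)
    (hδ₁ : 0 < δ₁) (hδ₂ : 0 < δ₂) (hδ₃ : 0 < δ₃) (hδ₄ : 0 < δ₄) (hCV : 0 ≤ CV) (hCD : 0 ≤ CD) (hCH : 0 ≤ CH) (hCM : 0 ≤ CM)
    (hV : ∀ (x x' : HiggsLattice.Site P 0), Interior k K₀ Ω₂ x → Interior k K₀ Ω₂ x' →
      (P.mesh 0 ^ P.d)⁻¹ * ∑ i' : Ix N, ‖dG C Ω Ω₂ A msq a k (cb P N 0 (x', i')) x‖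
        ≤ CV * (P.mesh k ^ 2 * (P.mesh k ^ P.d)⁻¹) * Real.exp (-(δ₁ * ((HiggsLattice.Site.tdist x x' : ℝ) / (P.L : ℝ) ^ k))) *
          Real.exp (-(δ₁ * ((distC Ω₂ x + distC Ω₂ x') / (P.L : ℝ) ^ k))))
    (hDv : ∀ (μ : Fin P.d) (x x' : HiggsLattice.Site P 0), Interior k K₀ Ω₂ x → Interior k K₀ Ω₂ x' →
      (P.mesh 0 ^ P.d)⁻¹ * ∑ i' : Ix N, ‖covDeriv C A (dG C Ω Ω₂ A msq a k (cb P N 0 (x', i'))) ⟨x, μ⟩‖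
        ≤ CD * (P.mesh k * (P.mesh k ^ P.d)⁻¹) * Real.exp (-(δ₂ * ((HiggsLattice.Site.tdist x x' : ℝ) / (P.L : ℝ) ^ k))) *
          Real.exp (-(δ₂ * ((distC Ω₂ x + distC Ω₂ x') / (P.L : ℝ) ^ k))))
    (hH : ∀ (μ : Fin P.d) (x₁ x₂ x' : HiggsLattice.Site P 0) (Γ : List (HiggsLattice.Site P 0)),
      Interior k K₀ Ω₂ x₁ → Interior k K₀ Ω₂ x₂ → Interior k K₀ Ω₂ x' → x₁ ≠ x₂ → IsAdm x₁ x₂ Γ →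
      (P.mesh 0 ^ P.d)⁻¹ * ∑ i' : Ix N, ‖hol C A x₁ Γ (covDeriv C A (dG C Ω Ω₂ A msq a k (cb P N 0 (x', i'))) ⟨x₂, μ⟩)
          - covDeriv C A (dG C Ω Ω₂ A msq a k (cb P N 0 (x', i'))) ⟨x₁, μ⟩‖
        ≤ (P.mesh 0 * (HiggsLattice.Site.tdist x₁ x₂ : ℝ)) ^ α * (CH * (P.mesh k * (P.mesh k ^ P.d)⁻¹ * (P.mesh k ^ α)⁻¹)) *
          Real.exp (-(δ₃ * (min (HiggsLattice.Site.tdist x₁ x' : ℝ) (HiggsLattice.Site.tdist x₂ x' : ℝ) / (P.L : ℝ) ^ k))) *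
          Real.exp (-(δ₃ * (min (min (distC Ω₂ x₁) (distC Ω₂ x₂)) (distC Ω₂ x') / (P.L : ℝ) ^ k))))
    (hM : ∀ (μ ν : Fin P.d) (x x' : HiggsLattice.Site P 0), Interior k K₀ Ω₂ x → Interior k K₀ Ω₂ x' →
      (P.mesh 0 ^ P.d)⁻¹ * ((P.mesh 0)⁻¹ *
          ∑ i : Ix N, ‖covDeriv C A (dG C Ω Ω₂ A msq a k (dip C A ⟨x', ν⟩ (onb N i))) ⟨x, μ⟩‖)
        ≤ CM * (P.mesh k ^ P.d)⁻¹ * Real.exp (-(δ₄ * ((HiggsLattice.Site.tdist x x' : ℝ) / (P.L : ℝ) ^ k))) *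
          Real.exp (-(δ₄ * ((distC Ω₂ x + distC Ω₂ x') / (P.L : ℝ) ^ k)))) :
    (sect2DeltaSmooth hL1 C Ω Ω₂ A msq a k K₀ r₀ m c₁ c₂).Ineq25 α (min (min δ₁ δ₂) (min δ₃ δ₄))
      (smoothConst P.d m c₁ (c₂ + 2 * c₁) * (CV + CD) + (CH + P.d * m * CM)) := by
  obtain ⟨δ, hδdef⟩ : ∃ δ : ℝ, δ = min (min δ₁ δ₂) (min δ₃ δ₄) := ⟨_, rfl⟩
  rw [← hδdef]
  have hδ : 0 < δ := by rw [hδdef]; exact lt_min (lt_min hδ₁ hδ₂) (lt_min hδ₃ hδ₄)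
  have hle₁ : δ ≤ δ₁ := by rw [hδdef]; exact (min_le_left _ _).trans (min_le_left _ _)
  have hle₂ : δ ≤ δ₂ := by rw [hδdef]; exact (min_le_left _ _).trans (min_le_right _ _)
  have hle₃ : δ ≤ δ₃ := by rw [hδdef]; exact (min_le_right _ _).trans (min_le_left _ _)
  have hle₄ : δ ≤ δ₄ := by rw [hδdef]; exact (min_le_right _ _).trans (min_le_right _ _)
  have hS : ∀ μ, 2 < P.sitesPerDir 0 μ := two_lt_sitesPerDir (hk1.trans hkK) hL2
  have hmk := P.mesh_pos k
  have hm0 := P.mesh_pos 0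
  have hdC : ∀ x : HiggsLattice.Site P 0, 0 ≤ distC Ω₂ x := fun x => distC_nonneg _ _
  -- the four inputs with the common rate
  have hV' : ∀ (x x' : HiggsLattice.Site P 0), Interior k K₀ Ω₂ x → Interior k K₀ Ω₂ x' →
      (P.mesh 0 ^ P.d)⁻¹ * ∑ i' : Ix N, ‖dG C Ω Ω₂ A msq a k (cb P N 0 (x', i')) x‖
        ≤ CV * (P.mesh k ^ 2 * (P.mesh k ^ P.d)⁻¹) * Real.exp (-(δ * ((HiggsLattice.Site.tdist x x' : ℝ) / (P.L : ℝ) ^ k))) *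
          Real.exp (-(δ * ((distC Ω₂ x + distC Ω₂ x') / (P.L : ℝ) ^ k))) := by
    intro x x' hx hx'
    have := hdC x; have := hdC x'
    exact (hV x x' hx hx').trans (mul_le_mul (mul_le_mul_of_nonneg_left (exp_rate_mono hle₁ (by positivity)) (by positivity))
      (exp_rate_mono hle₁ (by positivity)) (Real.exp_pos _).le (by positivity))
  have hDv' : ∀ (μ : Fin P.d) (x x' : HiggsLattice.Site P 0), Interior k K₀ Ω₂ x → Interior k K₀ Ω₂ x' →
      (P.mesh 0 ^ P.d)⁻¹ * ∑ i' : Ix N, ‖covDeriv C A (dG C Ω Ω₂ A msq a k (cb P N 0 (x', i'))) ⟨x, μ⟩‖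
        ≤ CD * (P.mesh k * (P.mesh k ^ P.d)⁻¹) * Real.exp (-(δ * ((HiggsLattice.Site.tdist x x' : ℝ) / (P.L : ℝ) ^ k))) *
          Real.exp (-(δ * ((distC Ω₂ x + distC Ω₂ x') / (P.L : ℝ) ^ k))) := by
    intro μ x x' hx hx'
    have := hdC x; have := hdC x'
    exact (hDv μ x x' hx hx').trans (mul_le_mul (mul_le_mul_of_nonneg_left (exp_rate_mono hle₂ (by positivity)) (by positivity))
      (exp_rate_mono hle₂ (by positivity)) (Real.exp_pos _).le (by positivity))
  have hH' : ∀ (μ : Fin P.d) (x₁ x₂ x' : HiggsLattice.Site P 0) (Γ : List (HiggsLattice.Site P 0)),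
      Interior k K₀ Ω₂ x₁ → Interior k K₀ Ω₂ x₂ → Interior k K₀ Ω₂ x' → x₁ ≠ x₂ → IsAdm x₁ x₂ Γ →
      (P.mesh 0 ^ P.d)⁻¹ * ∑ i' : Ix N, ‖hol C A x₁ Γ (covDeriv C A (dG C Ω Ω₂ A msq a k (cb P N 0 (x', i'))) ⟨x₂, μ⟩)
          - covDeriv C A (dG C Ω Ω₂ A msq a k (cb P N 0 (x', i'))) ⟨x₁, μ⟩‖
        ≤ (P.mesh 0 * (HiggsLattice.Site.tdist x₁ x₂ : ℝ)) ^ α * (CH * (P.mesh k * (P.mesh k ^ P.d)⁻¹ * (P.mesh k ^ α)⁻¹)) *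
          Real.exp (-(δ * (min (HiggsLattice.Site.tdist x₁ x' : ℝ) (HiggsLattice.Site.tdist x₂ x' : ℝ) / (P.L : ℝ) ^ k))) *
          Real.exp (-(δ * (min (min (distC Ω₂ x₁) (distC Ω₂ x₂)) (distC Ω₂ x') / (P.L : ℝ) ^ k))) := by
    intro μ x₁ x₂ x' Γ hx₁ hx₂ hx' hne hΓ
    have := hdC x₁; have := hdC x₂; have := hdC x'
    have h0 : 0 ≤ (P.mesh 0 * (HiggsLattice.Site.tdist x₁ x₂ : ℝ)) ^ α * (CH * (P.mesh k * (P.mesh k ^ P.d)⁻¹ * (P.mesh k ^ α)⁻¹)) := by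
      have : 0 ≤ (P.mesh 0 * (HiggsLattice.Site.tdist x₁ x₂ : ℝ)) ^ α := Real.rpow_nonneg (by positivity) _
      have : 0 < P.mesh k ^ α := Real.rpow_pos_of_pos hmk α
      positivity
    have hmin1 : 0 ≤ min (HiggsLattice.Site.tdist x₁ x' : ℝ) (HiggsLattice.Site.tdist x₂ x' : ℝ) / (P.L : ℝ) ^ k :=
      div_nonneg (le_min (Nat.cast_nonneg _) (Nat.cast_nonneg _)) (by positivity)
    have hmin2 : 0 ≤ min (min (distC Ω₂ x₁) (distC Ω₂ x₂)) (distC Ω₂ x') / (P.L : ℝ) ^ k :=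
      div_nonneg (le_min (le_min (hdC _) (hdC _)) (hdC _)) (by positivity)
    exact (hH μ x₁ x₂ x' Γ hx₁ hx₂ hx' hne hΓ).trans (mul_le_mul (mul_le_mul_of_nonneg_left (exp_rate_mono hle₃ hmin1) h0)
      (exp_rate_mono hle₃ hmin2) (Real.exp_pos _).le (by positivity))
  have hM' : ∀ (μ ν : Fin P.d) (x x' : HiggsLattice.Site P 0), Interior k K₀ Ω₂ x → Interior k K₀ Ω₂ x' →
      (P.mesh 0 ^ P.d)⁻¹ * ((P.mesh 0)⁻¹ *
          ∑ i : Ix N, ‖covDeriv C A (dG C Ω Ω₂ A msq a k (dip C A ⟨x', ν⟩ (onb N i))) ⟨x, μ⟩‖)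
        ≤ CM * (P.mesh k ^ P.d)⁻¹ * Real.exp (-(δ * ((HiggsLattice.Site.tdist x x' : ℝ) / (P.L : ℝ) ^ k))) *
          Real.exp (-(δ * ((distC Ω₂ x + distC Ω₂ x') / (P.L : ℝ) ^ k))) := by
    intro μ ν x x' hx hx'
    have := hdC x; have := hdC x'
    exact (hM μ ν x x' hx hx').trans (mul_le_mul (mul_le_mul_of_nonneg_left (exp_rate_mono hle₄ (by positivity)) (by positivity))
      (exp_rate_mono hle₄ (by positivity)) (Real.exp_pos _).le (by positivity))
  rw [ineq25_smooth_iff]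
  refine ⟨fun f f' => ?_, fun n n' f f' => ?_⟩
  · exact normHGHDS_le hS hα0 hα1 hδ.le hCV hCD hCH hCM hc₁ hc₂ hV' hDv' hH' hM' f.dom f'.dom (setDist_nonneg k f.supp f'.supp)
      (fun x hx x' hx' => pow_mul_setDist_le hx hx') f.smooth f'.smooth
  · have := smoothConst_pos P.d m hc₁ (by positivity : 0 ≤ c₂ + 2 * c₁)
    positivity

/-- kernel: `(L^kε)^{2−d} = (L^kε)²·((L^kε)^d)^{−1}`. [folklore] -/
private theorem rpow_two_sub (P : HiggsLattice.Params) (k : ℕ) :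
    P.mesh k ^ ((2 : ℝ) - (P.d : ℝ)) = P.mesh k ^ 2 * (P.mesh k ^ P.d)⁻¹ := by
  rw [Real.rpow_sub (P.mesh_pos k), Real.rpow_two, Real.rpow_natCast, div_eq_mul_inv]

/-- kernel: `(L^kε)^{1−d} = (L^kε)·((L^kε)^d)^{−1}`. [folklore] -/
private theorem rpow_one_sub (P : HiggsLattice.Params) (k : ℕ) :
    P.mesh k ^ ((1 : ℝ) - (P.d : ℝ)) = P.mesh k * (P.mesh k ^ P.d)⁻¹ := by
  rw [Real.rpow_sub (P.mesh_pos k), Real.rpow_one, Real.rpow_natCast, div_eq_mul_inv]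

/-- kernel: r14's currency `δ·(L^kε)^{−1}·(ε·m) = δ·(m/L^k)`. [folklore] -/
private theorem scale_inv_mul' (k : ℕ) (δ m : ℝ) : δ * (P.mesh k)⁻¹ * (P.mesh 0 * m) = δ * (m / (P.L : ℝ) ^ k) := by
  rw [mesh_eq_pow_mul P k]
  have hε : P.mesh 0 ≠ 0 := (P.mesh_pos 0).ne'
  have hL : (P.L : ℝ) ^ k ≠ 0 := pow_ne_zero _ (by have := P.hL; positivity)
  field_simp

set_option maxHeartbeats 1600000 in
/-- **INEQUALITY (2.5) OF [B3] FOR `δG_k(Ω,Ω₂,B̃)` WITH PRINT'S SMOOTH LOCALIZATION FUNCTIONS (p. 420), AT A REGULAR NON-CONSTANT BACKGROUND `B̃ = A`,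
NESTED BIG-BLOCK REGIONS `Ω₂ ⊆ Ω ⊂ T_ε`, PROVED FOR THE CARRIER `sect2DeltaSmooth` OF THE DECL OF RECORD `ScaledKernels.Ineq25`/`Ineq25At`.**  For
`d ≥ 1`, `L ≥ 2`, `a, m² > 0`, `c ≥ 0`, `N`, a support size `m` and bump constants `c₁, c₂ ≥ 0`: `∃E₀ > 0 ∀C (e² ≤ E₀) ∃K₀min ∀ 0 ≤ α < 1 ∀K₀ ≥ K₀min
∃ t, δ₀, C > 0` such that for every volume (`d`, `L`, `K₀ ∣ M`), every `1 ≤ k ≤ K` with `L^kε ≤ 1` and three big blocks a side (`3L^kK₀ ≤ |T_ε|_μ`), every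
nested pair of unions of big blocks `Ω₂ ⊆ Ω`, every `A` that is `δ_A`-regular ON `Ω` ((I.2.23)) with `L^kδ_A|e| ≤ t` and `L^kδ_A ≤ c|e|`, and every margin
`r₀`: `(sect2DeltaSmooth _ C Ω Ω₂ A m² a k K₀ r₀ m c₁ c₂).Ineq25 α δ₀ C`, i.e. `‖hδG_k(Ω,Ω₂,A)h′‖_{1,α} ≤ C·e^{−δ₀r₀}·e^{−δ₀dist(supp h,supp h′)}` in the
full-lattice (1.32) sum norm with transports, for ALL smooth bumps `h, h′` (p40's class, constants `c₁, c₂`) supported with collar in admissible domains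
of interior points of `Ω₂` at lattice distance `≥ r₀L^k` from `Ω₂ᶜ` (and the (1.16) clause trivially — not modelled).  Inputs BY NAME: r14's
`dG_kernel_bound_explicit`/`dG_kernel_deriv_bound_explicit` (p345219), p33 g60's `dG_holder_bound_explicit`/`dG_mixed_bound_explicit` (p346606), and
`ineq25_smooth_of_bounds`.  Honest scope: module docstring (F7). [cite: Balaban1983Higgs3, (2.5)–(2.6) p.424, (1.16) p.414, (1.32) p.420, p.420, (2.10)–(2.12) p.426]
[cite: Balaban1982Higgs1, Prop. 2.1 (2.24)–(2.26) p.610, Prop. 2.3 (2.34)–(2.38) pp.611–612] -/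
theorem ineq25_smooth_regularNested (d L : ℕ) (hd : 1 ≤ d) (hL : 2 ≤ L) {a : ℝ} (ha : 0 < a) {msq : ℝ} (hmsq : 0 < msq)
    {c : ℝ} (hc : 0 ≤ c) (N : ℕ) (m : ℕ) {c₁ c₂ : ℝ} (hc₁ : 0 ≤ c₁) (hc₂ : 0 ≤ c₂) :
    ∃ E₀ : ℝ, 0 < E₀ ∧ ∀ (C : ChargeData N), C.e ^ 2 ≤ E₀ →
      ∃ K₀min : ℕ, ∀ {α : ℝ}, 0 ≤ α → α < 1 → ∀ K₀ : ℕ, K₀min ≤ K₀ → ∃ t δ₀ Cst : ℝ, 0 < t ∧ 0 < δ₀ ∧ 0 < Cst ∧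
      ∀ (P : HiggsLattice.Params) (hP1 : 1 < P.L), P.d = d → P.L = L → K₀ ∣ P.M →
      ∀ {k : ℕ}, 1 ≤ k → k ≤ P.K → (∀ μ, 3 * half P k K₀ ≤ P.sitesPerDir 0 μ) → P.mesh k ≤ 1 →
      ∀ (Ω Ω₂ : Finset (HiggsLattice.Site P 0)), IsBigBlockUnion k K₀ Ω → IsBigBlockUnion k K₀ Ω₂ → Ω₂ ⊆ Ω →
      ∀ (A : HiggsLattice.VecField P 0) {δA : ℝ}, 0 ≤ δA →
        (∀ z ∈ Ω, ∀ μ ν : Fin P.d, |A ⟨z.shift ν, μ⟩ - A ⟨z, μ⟩| ≤ δA) →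
        (P.L : ℝ) ^ k * δA * |C.e| ≤ t → (P.L : ℝ) ^ k * δA ≤ c * |C.e| →
        ∀ r₀ : ℕ, (sect2DeltaSmooth hP1 C Ω Ω₂ A msq a k K₀ r₀ m c₁ c₂).Ineq25 α δ₀ Cst := by
  obtain ⟨E₁, hE₁, h1⟩ := dG_kernel_bound_explicit d L hd hL ha hmsq hc N
  obtain ⟨E₂, hE₂, h2⟩ := dG_kernel_deriv_bound_explicit d L hd hL ha hmsq hc N
  obtain ⟨E₃, hE₃, h3⟩ := dG_holder_bound_explicit d L hd hL ha hmsq hc N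
  obtain ⟨E₄, hE₄, h4⟩ := dG_mixed_bound_explicit d L hd hL ha hmsq hc N
  refine ⟨min (min E₁ E₂) (min E₃ E₄), lt_min (lt_min hE₁ hE₂) (lt_min hE₃ hE₄), fun C heE => ?_⟩
  have he1 : C.e ^ 2 ≤ E₁ := heE.trans ((min_le_left _ _).trans (min_le_left _ _))
  have he2 : C.e ^ 2 ≤ E₂ := heE.trans ((min_le_left _ _).trans (min_le_right _ _))
  have he3 : C.e ^ 2 ≤ E₃ := heE.trans ((min_le_right _ _).trans (min_le_left _ _))
  have he4 : C.e ^ 2 ≤ E₄ := heE.trans ((min_le_right _ _).trans (min_le_right _ _))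
  obtain ⟨K₁, hK₁⟩ := h1 C he1
  obtain ⟨K₂, hK₂⟩ := h2 C he2
  obtain ⟨K₃, hK₃⟩ := h3 C he3
  obtain ⟨K₄, hK₄⟩ := h4 C he4
  refine ⟨max (max K₁ K₂) (max K₃ K₄), fun {α} hα0 hα1 K₀ hK₀ => ?_⟩
  obtain ⟨t₁, δ₁, C₁, ht₁, hδ₁, hC₁, hm1⟩ := hK₁ K₀ ((le_max_left K₁ K₂).trans ((le_max_left _ _).trans hK₀))
  obtain ⟨t₂, δ₂, C₂, ht₂, hδ₂, hC₂, hm2⟩ := hK₂ K₀ ((le_max_right K₁ K₂).trans ((le_max_left _ _).trans hK₀))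
  obtain ⟨t₃, δ₃, C₃, ht₃, hδ₃, hC₃, hm3⟩ := hK₃ hα0 hα1 K₀ ((le_max_left K₃ K₄).trans ((le_max_right _ _).trans hK₀))
  obtain ⟨t₄, δ₄, C₄, ht₄, hδ₄, hC₄, hm4⟩ := hK₄ K₀ ((le_max_right K₃ K₄).trans ((le_max_right _ _).trans hK₀))
  have hKc := smoothConst_pos d m hc₁ (by positivity : 0 ≤ c₂ + 2 * c₁)
  refine ⟨min (min t₁ t₂) (min t₃ t₄), min (min δ₁ δ₂) (min δ₃ δ₄),
    smoothConst d m c₁ (c₂ + 2 * c₁) * (C₁ + C₂) + (C₃ + d * m * C₄),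
    lt_min (lt_min ht₁ ht₂) (lt_min ht₃ ht₄), lt_min (lt_min hδ₁ hδ₂) (lt_min hδ₃ hδ₄), by positivity, ?_⟩
  intro P hP1 hPd hPL hK₀M k hk1 hkK h3h hmesh Ω Ω₂ hΩ hΩ₂ hsub A δA hδA hreg htA hcA r₀
  have ht1 : (P.L : ℝ) ^ k * δA * |C.e| ≤ t₁ := htA.trans ((min_le_left _ _).trans (min_le_left _ _))
  have ht2 : (P.L : ℝ) ^ k * δA * |C.e| ≤ t₂ := htA.trans ((min_le_left _ _).trans (min_le_right _ _))
  have ht3 : (P.L : ℝ) ^ k * δA * |C.e| ≤ t₃ := htA.trans ((min_le_right _ _).trans (min_le_left _ _))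
  have ht4 : (P.L : ℝ) ^ k * δA * |C.e| ≤ t₄ := htA.trans ((min_le_right _ _).trans (min_le_right _ _))
  have hV := hm1 P hP1 hPd hPL hK₀M hk1 hkK h3h hmesh Ω Ω₂ hΩ hΩ₂ hsub A hδA hreg ht1 hcA
  have hDv := hm2 P hP1 hPd hPL hK₀M hk1 hkK h3h hmesh Ω Ω₂ hΩ hΩ₂ hsub A hδA hreg ht2 hcA
  have hH := hm3 P hP1 hPd hPL hK₀M hk1 hkK h3h hmesh Ω Ω₂ hΩ hΩ₂ hsub A hδA hreg ht3 hcA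
  have hM := hm4 P hP1 hPd hPL hK₀M hk1 hkK h3h hmesh Ω Ω₂ hΩ hΩ₂ hsub A hδA hreg ht4 hcA
  subst hPd hPL
  refine ineq25_smooth_of_bounds hL hk1 hkK hα0 hα1.le hc₁ hc₂ hδ₁ hδ₂ hδ₃ hδ₄ hC₁.le hC₂.le hC₃.le hC₄.le ?_ ?_ hH hM
  · intro x x' hx hx'
    have h := hV x x' hx hx'
    rw [scale_inv_mul', scale_inv_mul', rpow_two_sub] at h
    exact h
  · intro μ x x' hx hx'
    have h := hDv μ x x' hx hx'
    rw [scale_inv_mul', scale_inv_mul', rpow_one_sub] at h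
    exact h

/-- **Corollary (the printed shape, first conjunct)**: under the data of `ineq25_smooth_regularNested`, for every pair of smooth localization functions
`‖hδG_k(Ω,Ω₂,A)h′‖_{1,α} ≤ C·e^{−δ₀r₀}·e^{−δ₀dist(supp h, supp h′)}` — (2.5) with `dist(Ω₂,∂Ω)` read as the margin `r₀` of the localizations; in
particular the printed per-(n,n′) form `Ineq25At n n'` holds for every `n, n′`. [cite: Balaban1983Higgs3, (2.5) p.424, (1.32) p.420] -/
theorem normHGHDS_le_of_ineq25 {P : HiggsLattice.Params} {N : ℕ} {hL1 : 1 < P.L} {C : ChargeData N}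
    {Ω Ω₂ : Finset (HiggsLattice.Site P 0)} {A : HiggsLattice.VecField P 0} {msq a : ℝ} {k K₀ r₀ m : ℕ} {c₁ c₂ α δ₀ Cst : ℝ}
    (h : (sect2DeltaSmooth hL1 C Ω Ω₂ A msq a k K₀ r₀ m c₁ c₂).Ineq25 α δ₀ Cst) (f f' : SmoothLocFn k K₀ Ω₂ r₀ m c₁ c₂) :
    normHGHDS C Ω Ω₂ A msq a k α f.fn f'.fn ≤ Cst * Real.exp (-(δ₀ * (r₀ : ℝ))) * Real.exp (-(δ₀ * setDist k f.supp f'.supp)) ∧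
      ∀ n n' : ℕ, (sect2DeltaSmooth hL1 C Ω Ω₂ A msq a k K₀ r₀ m c₁ c₂).Ineq25At n n' α δ₀ Cst :=
  ⟨((ineq25_smooth_iff α δ₀ Cst).mp h).1 f f', fun n n' => B3Sect2StatementsPart2.ScaledKernels.Ineq25.ineq25At _ h n n'⟩

end Carrier

end Literature.MathematicalPhysics.QuantumFieldTheory.Balaban1983to89.B3Ineq25SmoothLocalization

end
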